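import Mathlib.Analysis.SpecialFunctions.NonIntegrable
import Mathlib.Analysis.SpecialFunctions.SmoothTransition
import Mathlib.MeasureTheory.Integral.IntegralEqImproper
import Mathlib.MeasureTheory.Integral.IntervalIntegral.Basic
import Literature.Geometry.Lorentzian.EnergyCurrents
import Literature.Geometry.Lorentzian.KerrWaveDecay
import HarnessLib

/-!
# Energy fluxes of waves on Kerr through hyperboloidal leaves; DRSR Corollary 3.1 in flux form
(trunk G08 = T-LORENTZ; statement **gr.S24**; namespace `Literature.Lorentz.Kerr`)

This file belongs to the decomposition of the named fact `Literature.Geometry.Lorentzian.drsr_wave_polynomial_decay_kerr`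
(`BlackHoles.lean`; Dafermos–Rodnianski–Shlapentokh-Rothman, arXiv:1402.7034 = Ann. of Math. 183
(2016), Cor. 3.1). The companion files `KerrWaveEnergy.lean` (boundedness (23) for admissible
graph hypersurfaces, finite speed of propagation) and `KerrWaveDecay.lean` (Thm. 3.2 (25),
Cor. 3.1 (30)–(31) in local coordinate form, and `drsr_wave_polynomial_decay_kerr_of_derivative_decay`)
work with *coordinate* energies through asymptotically flat leaves and record that the remaining
arrow of the printed chain — the energy-flux estimate of Cor. 3.1 through a **hyperboloidal**
foliation — "is not expressible with the present prelude (no hyperboloidal leaves, `J^N`-fluxes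
…)". This file supplies that vocabulary on the ingoing Kerr–Schild exterior chart
`Kerr.exterior M a = {r > r₊} ⊆ E4`: the energy flux `∫_{Σ̃_τ} J^N_μ[ψ] n^μ_{Σ̃_τ}` of a wave `ψ`
through the leaves `Σ̃_τ = φ_τ(Σ̃₀)` of a stationary hyperboloidal foliation (on such leaves the
flux density degenerates towards null infinity and is *not* comparable to the coordinate energy,
so the graph energies of `KerrWaveEnergy.lean` cannot be used). It then vendors the first
estimate of Cor. 3.1, for one concrete hyperboloidal foliation terminating at future null
infinity `𝓘⁺`, as the named fact `Kerr.drsr_corollary_3_1_scri_flux_decay`, and **proves** that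
`Literature.Geometry.Lorentzian.drsr_wave_polynomial_decay_kerr` follows from it
(`Literature.Geometry.Lorentzian.drsr_wave_polynomial_decay_kerr_of_corollary_3_1_scri`, through the generic
`Literature.Geometry.Lorentzian.drsr_wave_polynomial_decay_kerr_of_leafFlux_decay`) — a second, independent reduction of
that fact, complementary to the one from the pointwise estimate (31) in `KerrWaveDecay.lean`.
**Erratum (2026-08-14).** The first version of this file stated the estimate for the foliation
`Σ̃_τ(h_{R₁})` built on the prototype `Σ₂ = {t* = r + M log r}` exactly as printed in
arXiv:1010.5132, §4.4; those leaves reach spacelike infinity `i⁰` rather than `𝓘⁺` and the energy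
flux through them does **not** decay, so that named fact
(`Kerr.drsr_corollary_3_1_hyperboloidal_flux_decay`) is false as written. It is kept, flagged, for
the record (D-0014 house rule: never change a vendored statement in place); see *Erratum* below.

* Kerr–Schild bookkeeping (`Kerr.radius_ofTimeSpace`, `Kerr.radius_le_spatialNorm : r ≤ ‖x⃗‖`,
  `Kerr.radius_ofTimeSpace_le_norm`, finite speed of propagation, …) is imported from
  `KerrWaveEnergy.lean` / `KerrWaveDecay.lean`.
* `Kerr.cutoffProfile σ R₁ r = ∫_{R₁}^r χ((s − R₁)/R₁) σ(s) ds` and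
  `Kerr.cutoffHeight σ a R₁ y = cutoffProfile σ R₁ (r(0, y))` (`χ = Real.smoothTransition`): height
  functions of graph foliations `{t*_KS = τ + h(y)}` which are the Kerr–Schild slice on `{r ≤ R₁}`
  (`cutoffHeight_eq_zero_of_radius_le`, `fderiv_cutoffHeight_eq_zero`) and have `t*_KS`-slope
  `σ(r)` for `r ≥ 2R₁`.
* `Kerr.scriSlope M a s = r*'(s) + 2M/s` (`r*' = (s² + a²)/Δ`, `Δ = (s − r₊)(s − r₋)`),
  `Kerr.scriProfile`, `Kerr.scriHeight M a R₁ : E3 → ℝ`: the foliation `Σ̃_τ(h♯_{R₁})` whose leaves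
  are `{t = r + 2M log r + c}` far out in Boyer–Lindquist time and **terminate at `𝓘⁺`**
  (see *The corrected foliation* below); `Kerr.sub_rPlus_mul_sub_rMinus` (`Δ = s² − 2Ms + a²`)
  and `Kerr.outgoingNullSlope_sub_scriSlope` (proved: the leaves lag behind the outgoing null
  cones at the rate `2M(2Ms − a²)/(sΔ)`), `Kerr.hypSlope_eq_scriSlope_sub`;
  **the dichotomy behind the erratum, proved**: `Kerr.integrableOn_outgoingNullSlope_sub_scriSlope`
  (that lag is integrable on `[R, ∞)`, `R > r₊`: `u` converges along the corrected leaves, which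
  terminate at `𝓘⁺` in the sense of Moschidis, arXiv:1509.08489, Def. 3.2) and
  `Kerr.not_integrableOn_outgoingNullSlope_sub_hypSlope` (the first version's lag `… + M/s` is
  not: `u → −∞`, those leaves reach `i⁰`); auxiliary `IsSubextremal.sq_lt_sq`, `.M_lt_rPlus`,
  `.rPlus_pos`, `.rPlus_sq` (`r₊² = 2Mr₊ − a²`), `sub_rPlus_mul_sub_rMinus_pos`.
* `Kerr.hypSlope M a s = r*'(s) + M/s`, `Kerr.hypProfile`, `Kerr.hypHeight` (first version, kept):
  the leaves `{t = r + M log r + c}` of the prototype `Σ₂` as printed in arXiv:1010.5132, §4.4,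
  which reach `i⁰` (see *Erratum*).
* `Kerr.leafPoint h τ y = (τ + h y, y)`: the leaf `Σ̃_τ(h) = {t* = τ + h(y)} ∩ {r > r₊}` of the
  graph foliation with height `h` (stationary: `Σ̃_τ = φ_τ Σ̃₀`, `φ_τ` the `t*`-translation);
  `Kerr.leafConormal h x = d(t* − h∘spatial)_x`; `Kerr.leafNormal M a h x = −g♯ d(t* − h)`, the
  (un-normalised) future normal; for `dh = 0` it is `V = −g♯dt* = Kerr.timeVector`
  (`leafNormal_eq_timeVector`, from `sharp_dx_zero : g♯(dt*) = −V`).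
* `Kerr.leafFluxDensity`, `Kerr.leafFlux M a h ψ τ = ∫ T[ψ](V, −g♯d(t* − h)) (τ + h y, y) dy`
  (`ℝ≥0∞`-valued Lebesgue integral over `y ∈ E3`, density cut off to the exterior): the flux
  `∫_{Σ̃_τ} J^V_μ[ψ] n^μ dσ` of the current of the multiplier `V` through the leaf. Indeed in
  Kerr–Schild Cartesian coordinates `det g = det η = −1` (`g = A^*η`, `det A = 1 + H ℓ(ℓ♯) = 1`),
  so `dVol_g = dt* dy = dt̃ dy` for `t̃ = t* − h(y)`, while `dVol_g = |∇t̃|⁻¹ dt̃ dσ` and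
  `n = −g♯dt̃/|∇t̃|`; hence `J^V_μ n^μ dσ = T[ψ](V, −g♯dt̃) dy` exactly.
* `Kerr.etaSharp`, `Kerr.coSharp` and `Kerr.sharp_smoothMetric`: the explicit inverse metric
  `g♯p = η♯p − 2H p(ℓ♯) ℓ♯` (proved to be the prelude's `♯`); `Kerr.sum_sq_nullCovectorFun`
  (`|ℓ⃗| = 1`).
* `Kerr.sum_sq_mvfderiv_le_four_mul_stressEnergy`, `Kerr.coordEnergyDensity_le_four_mul_stressEnergy`
  (**proved coercivity**): `∑_μ (∂_μψ)² ≤ 4 T[ψ](V, V)` pointwise, for `M ≥ 0`, with the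
  universal constant `4`; `Literature.Geometry.Lorentzian.mvfderiv_eq_fderiv_extend` identifies the manifold
  differential on an open `U ⊆ E4` with the derivative of the zero extension used by
  `coordEnergyDensity`.
* `Kerr.drsr_corollary_3_1_scri_flux_decay` (**named fact**, D-0014): DRSR Cor. 3.1, first
  estimate, for the foliation `Σ̃_τ(h♯_{R₁})` terminating at `𝓘⁺`.
* `Kerr.drsr_corollary_3_1_hyperboloidal_flux_decay` (**mis-stated named fact, false as written,
  kept flagged**): the same estimate for the `i⁰`-reaching foliation `Σ̃_τ(h_{R₁})` (see *Erratum*).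
* `Literature.Geometry.Lorentzian.drsr_wave_polynomial_decay_kerr_of_leafFlux_decay` (**proved**): the named fact of
  `BlackHoles.lean` follows from `τ⁻²` decay of the `V`-flux through the leaves of *any* graph
  foliation whose height functions vanish on `{r ≤ R₁}` (there the leaf is the Kerr–Schild slice
  with normal `V`, and `E_loc ≤ 4 · flux`); `…_of_corollary_3_1_scri` is the instance for
  `h♯_{R₁}` (the live reduction) and `…_of_corollary_3_1` the instance for `h_{R₁}` (vacuous, kept).

## Implementation note

In binders we write the exterior chart as `Kerr.region a (Kerr.rPlus M a)`, to which
`Kerr.exterior M a` is *definitionally* equal (`KerrSchild.lean`), so that subtype terms stay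
type-correct at reducible transparency when combined with `Kerr.smoothMetric M a r₊`, whose base
is `Kerr.region a r₊`; statements about `ψ : Kerr.exterior M a → ℝ` apply verbatim.

## The multiplier `V` versus DRSR's `N`

DRSR state Thm. 3.1/Cor. 3.1 with the red-shift vector field `N` of their Prop. 4.5.1 but note
(arXiv:1402.7034, footnote to §3.1, p. 13 of the held text): "for the statement of Theorem 3.1,
the only important feature of `N` is that it is `φ_τ`-invariant, strictly timelike and asymptotic
to `T` for large `r`". The Kerr–Schild field `V = −g♯dt* = ∂_{t*} − 2Hℓ♯` (`Kerr.timeVector`) has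
exactly these features (`g(V,V) = −1 − 2H < 0` up to and on `𝓗⁺`, `H → 0`), and for two such
fields the flux densities `T[ψ](N, n)`, `T[ψ](V, n)` through any future causal `n` are comparable
with constants `C(M, a)` (dominant energy condition, `EnergyCurrents.lean`, applied to
`C N − V` and `C V − N`, which are future timelike for `C = C(M, a)`). Since the vendored estimate
has an unspecified finite constant, stating it with `V` is faithful.

## Erratum (2026-08-14): the leaves `Σ̃_τ(h_{R₁})` of the first version reach `i⁰`, not `𝓘⁺`

DRSR's Kerr-star time `t*_DRSR` equals Boyer–Lindquist `t` for `r ≥ 9M/4` (arXiv:1402.7034,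
§2.1.3; arXiv:1010.5132, §2.4), whereas the chart time here is the ingoing Kerr–Schild time
`t*_KS = t + r*(r) − r` (up to a constant; `dr*/dr = (r² + a²)/Δ = 1 + 2M/r + 4M²/r² + O(r⁻³)`, so
`r* = r + 2M log r + O(1)`). The first version of this file used the height `h_{R₁}`
(`Kerr.hypHeight`, `t*_KS`-slope `r*' + M/r`), whose leaves are, for `r ≥ 2R₁`, exact translates
of the prototype "`Σ₂ = {t* = χ(α(y* − R))·(r + M log r)}`" **as printed** in arXiv:1010.5132,
§4.4, i.e. `{t = r + M log r + c}` far out. Along such a leaf the retarded time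
`u = t − r* = −M log r + O(1)` tends to `−∞`: for every fixed `u₀` the outgoing null ray
`{t = u₀ + r*}` lies *above* the leaf for large `r` (`t_ray − t_leaf = u₀ + M log r + O(1)`), so the
leaf passes below every point of `𝓘⁺` and ends at spacelike infinity `i⁰` (it is spacelike and
asymptotically null, but does not terminate at null infinity: `u` is unbounded on it, whereas
"terminating at `𝓘⁺`" means precisely that `u` stays bounded, Moschidis, arXiv:1509.08489,
Def. 3.2), and the slab between two leaves has no boundary portion on `𝓘⁺`. Consequently the
energy flux through `Σ̃_τ(h_{R₁})` does **not** decay: for `τ` large, the `J^T` energy identity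
(`T` Killing, timelike for `r ≥ R_e`) on the region `{r ≥ R_e} ∩ J⁺(Σ̃_τ(h_{R₁})) ∩ {u ≤ u_b}`
(which does not meet `{r = R_e}` once `τ` is large),
whose remaining boundary consists of a portion of the outgoing cone `{u = u_b}` (non-negative
flux) and of `𝓘⁺ ∩ {u ≤ u_b}`, bounds the flux through
`Σ̃_τ(h_{R₁}) ∩ {r ≥ R_e}` from below by the energy radiated to `𝓘⁺` up to the retarded time `u_b`,
a positive constant independent of `τ` for every solution radiating to `𝓘⁺` (and
`J^V_μ n^μ ≥ c(M, a) J^T_μ n^μ` there). Hence the first version's named fact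
`Kerr.drsr_corollary_3_1_hyperboloidal_flux_decay` is **false as written**; the hypothesis of
Cor. 3.1 ("an asymptotically hyperboloidal hypersurface terminating at null infinity") is not met
by `Σ̃₀(h_{R₁})`. The same argument shows that Thm. 1.4 of arXiv:1010.5132 cannot hold for the
literal `Σ₂`, whereas arXiv:1010.5132, p. 17 asserts that `Σ₂` "asymptotes to null infinity":
the printed `M log r` is evidently a slip for a profile terminating at `𝓘⁺` such as
`r + 2M log r` (the tortoise logarithm, cf. `t* = t + 2M log(r − 2M)` in arXiv:0811.0354, §2.2),
which is what `Kerr.scriSlope` implements. The target fact `Literature.Geometry.Lorentzian.drsr_wave_polynomial_decay_kerr`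
(local energy on Kerr–Schild slices) is unaffected.

## The corrected foliation `Σ̃_τ(h♯_{R₁})` terminating at `𝓘⁺`

`h♯_{R₁} = Kerr.scriHeight M a R₁` has `t*_KS`-slope `χ · (r*' + 2M/r)`, i.e. the leaf
`Σ̃₀(h♯_{R₁})` is the Kerr–Schild slice `{t*_KS = 0}` on `{r ≤ R₁}` (spacelike through `𝓗⁺`,
`g⁻¹(dt*, dt*) = −1 − 2H < 0`, meeting `𝓗⁺` transversally in a sphere) and, in Boyer–Lindquist
time, the graph `t = G(r)` with `G' = χ (1 + 2M/r) + (1 − χ)(1 − r*')`. (i) *It terminates at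
`𝓘⁺`*: for `r ≥ 2R₁`, `du/dr = G' − r*' = −(r*' − 1 − 2M/r) = −2M(2Mr − a²)/(rΔ) ∼ −4M²/r²` is
integrable, so `u` decreases to a finite limit `u_∞` along the leaf (bounded `u`: the leaf
terminates at `𝓘⁺` in the precise sense of Moschidis, arXiv:1509.08489, Def. 3.2), which
approaches the cone `{u = u_∞}` with time lag `4M²/r + O(r⁻²)`, like a hyperboloid. (ii) *It is
spacelike for `R₁ ≥ R₀(M, a)`*: a graph `t = G(r)` is spacelike iff
`|G'| < S := ((r² + a²)² − a²Δ sin²θ)^{1/2}/Δ`, and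
`S ≥ ((r² + a²)² − a²Δ)^{1/2}/Δ = 1 + 2M/r + (4M² − a²/2)/r² + O(r⁻³)` exceeds `1 + 2M/r` for
`r ≥ R₀(M, a)` (`4M² − a²/2 > 0`), while the Kerr–Schild slope `1 − r*' = −2Mr/Δ` lies in `(−S, S)`
for all `r > r₊` (`(r² + a²)² − a²Δ − 4M²r² = r Δ (r + 2M) > 0`); the spacelike range being an
interval, every convex combination is spacelike. (iii) *Its part over `{r > R₁}` lies outside the
causal future of `{t*_KS = 0, r ≤ R₁}`* (for `R₁ ≥ R₀`): `t` is a time function on the exterior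
and future causal curves obey `dt ≥ S |dr| ≥ S₀(r) |dr|`, `S₀ := ((r² + a²)² − a²Δ)^{1/2}/Δ`
(`Δ/S` is the maximal radial coordinate speed of null vectors), while the Kerr–Schild slice has
slope `−2Mr/Δ ∈ (−S₀, S₀)` and the leaf has slope `G' < S₀` on `[R₁, ∞)`; so a causal curve from
`{t*_KS = 0, r' ≤ R₁}` reaches radius `r > R₁` at a Boyer–Lindquist time
`≥ t_{S₀}(R₁) + ∫_{R₁}^r S₀ > t_{leaf}(r)`. Consequently a solution whose data are supported in
`{t*_KS = 0, r ≤ R₁}` induces on `Σ̃₀(h♯_{R₁})` the same, compactly supported, data. (iv) Hence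
`Σ̃₀(h♯_{R₁})` is a smooth spacelike hypersurface of the Kerr exterior, transversal to `𝓗⁺` and
terminating at `𝓘⁺` — the hypothesis of Cor. 3.1 of arXiv:1402.7034 as restated in Moschidis,
arXiv:1509.08489, §1.3.3 (pp. 16–17 of the arXiv text: "`Σ̃₀` a smooth spacelike hypersurface …
intersecting transversally the future event horizon `𝓗⁺` and terminating at future null infinity
`𝓘⁺` … `N` a globally timelike, future directed and `T`-invariant vector field coinciding with `T`
in the region `{r ≫ 1}` … `∫_{Σ̃_τ} J^N_μ(φ) n^μ ≤ C · E τ⁻²`") — and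
`Σ̃_τ(h♯_{R₁}) = φ_τ Σ̃₀(h♯_{R₁})` for the `t*`-translations `φ_τ` (`T = ∂_{t*_KS} = ∂_t`).

## References

* M. Dafermos, I. Rodnianski, Y. Shlapentokh-Rothman, *Decay for solutions of the wave equation
  on Kerr exterior spacetimes III: the full subextremal case |a| < M*, Ann. of Math. 183 (2016)
  787–913, arXiv:1402.7034: §2.1 (coordinates), §3.1 Thm. 3.1 and footnote on `N` (p. 13 of the
  held text), §3.3 Cor. 3.1 (p. 14), §4.1 (reduction to smooth compactly supported data), p. 51
  (hyperboloidal `Σ̃₀` agreeing with `Σ₀` on `{r ≤ R}`) (key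
  `DafermosRodnianskiShlapentokhrothman2014`).
* M. Dafermos, I. Rodnianski, *Decay for solutions of the wave equation on Kerr exterior
  spacetimes I–II*, arXiv:1010.5132, §4.2 (currents), §4.4 Def. 4.1 (admissible hypersurfaces,
  prototype `Σ₂`), Prop. 4.5.1 (well-posedness and domain of dependence in `D⁺(Σ)`), Prop. 4.6.1
  (key `DafermosRodnianski2010KerrSmallA`).
* M. Dafermos, I. Rodnianski, *A new physical-space approach to decay for the wave equation with
  applications to black hole spacetimes*, arXiv:0910.4957 (the `r^p` "black box" behind Cor. 3.1;
  key `DafermosRodnianski2010ICMP`).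
* M. Dafermos, I. Rodnianski, *Lectures on black holes and linear waves*, arXiv:0811.0354, §2.2
  (`t* = t + 2M log(r − 2M)`), §5.1 (Kerr–Schild/Kerr-star coordinates), §13 = App. D (currents)
  (key `DafermosRodnianski2008`).
* G. Moschidis, *The `r^p`-weighted energy method of Dafermos and Rodnianski in general
  asymptotically flat spacetimes and applications*, Ann. PDE 2 (2016), arXiv:1509.08489, §1.3.3
  (restatement of DRSR Cor. 3.1, pp. 16–17 of the arXiv text), Def. 3.2 (p. 26: a hypersurface
  terminates at `𝓘⁺` iff `u` is bounded on it) (key `Moschidis2016`).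
-/

noncomputable section

open Bundle Set TopologicalSpace MeasureTheory Filter
open scoped Manifold ContDiff Topology ENNReal

namespace Literature.Geometry.Lorentzian

namespace Kerr

/-! ### The first version's height function `h_{R₁}` (prototype `Σ₂` as printed; reaches `i⁰`) -/

/-- The slope `σ(s) = r*'(s) + M/s = (s² + a²)/Δ(s) + M/s`, `Δ = (s − r₊)(s − r₋)`, of the profile
`r* + M log r` of the prototype hypersurface `Σ₂ = {t* = χ · (r + M log r)}` **as printed** in
Dafermos–Rodnianski arXiv:1010.5132, §4.4, written in Kerr–Schild time (`t*_KS = t + r* − r + c`,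
so the leaf is `{t = r + M log r + c}` far out; DRSR arXiv:1402.7034, §2.1.2 (2) for `r*`).
**Caveat (erratum in the module docstring):** these leaves reach spacelike infinity `i⁰`
(`u = t − r* = −M log r + O(1) → −∞` along them), not `𝓘⁺`; the foliation terminating at `𝓘⁺` is
built on `scriSlope` (`2M/s` in place of `M/s`). Junk where `Δ = 0` or `s = 0` (never used: only
`s ≥ R₁ > r₊`). [cite: DafermosRodnianski2010KerrSmallA, §4.4] -/
def hypSlope (M a s : ℝ) : ℝ :=
  (s ^ 2 + a ^ 2) / ((s - rPlus M a) * (s - rMinus M a)) + M / s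

/-- The radial profile `k_{R₁}(r) = ∫_{R₁}^r χ((s − R₁)/R₁) σ(s) ds` of the first version's height
(`χ = Real.smoothTransition`, so `k_{R₁} = 0` on `r ≤ R₁` and `k'_{R₁} = σ = hypSlope` on
`r ≥ 2R₁`): the leaf `{t*_KS = k_{R₁}(r)}` is the Kerr–Schild slice for `r ≤ R₁` and an exact
`t*`-translate of the prototype `Σ₂` as printed in arXiv:1010.5132, §4.4 for `r ≥ 2R₁` (it reaches
`i⁰`: erratum in the module docstring; the corrected profile is `scriProfile`). It equals
`cutoffProfile (hypSlope M a) R₁ r` (`hypProfile_eq_cutoffProfile`). DRSR arXiv:1402.7034, p. 51: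
"for any `1 ≪ R` one can easily find a hyperboloidal hypersurface which agrees with `Σ₀` on
`{r ≤ R}` and which lies to the future of `Σ₀`". [cite: DafermosRodnianskiShlapentokhrothman2014, §9 p. 51] -/
def hypProfile (M a R₁ r : ℝ) : ℝ :=
  ∫ s in R₁..r, Real.smoothTransition ((s - R₁) / R₁) * hypSlope M a s

/-- The height function `h_{R₁}(y) = k_{R₁}(r(0, y))` of the first version on the spatial
coordinate space `E3` of the Kerr–Schild chart; the leaves `Σ̃_τ(h_{R₁}) = {t* = τ + h_{R₁}(y)}`
are translates of the prototype `Σ₂` as printed in arXiv:1010.5132, §4.4 and reach `i⁰` (erratum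
in the module docstring; the corrected height is `scriHeight`). DRSR arXiv:1402.7034, §3.3 and
p. 51; arXiv:1010.5132, §4.4. [cite: DafermosRodnianskiShlapentokhrothman2014, §3.3 and p. 51] -/
def hypHeight (M a R₁ : ℝ) (y : E3) : ℝ :=
  hypProfile M a R₁ (radius a (E4.ofTimeSpace 0 y))

/-- `k_{R₁}(r) = 0` for `r ≤ R₁` (`0 ≤ R₁`): the cutoff `χ((s − R₁)/R₁)` vanishes on `s ≤ R₁`.
DRSR arXiv:1402.7034, p. 51. [folklore] -/
theorem hypProfile_eq_zero_of_le {M a R₁ r : ℝ} (hR : 0 ≤ R₁) (hr : r ≤ R₁) :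
    hypProfile M a R₁ r = 0 := by
  unfold hypProfile
  rw [intervalIntegral.integral_congr (g := fun _ ↦ (0 : ℝ)), intervalIntegral.integral_zero]
  intro s hs
  rw [Set.uIcc_of_ge hr] at hs
  have hs' : (s - R₁) / R₁ ≤ 0 := div_nonpos_of_nonpos_of_nonneg (by linarith [hs.2]) hR
  simp [Real.smoothTransition.zero_of_nonpos hs']

/-- `h_{R₁}(y) = 0` whenever `r(0, y) ≤ R₁` (`0 ≤ R₁`): on `{r ≤ R₁}` the leaf `Σ̃_τ` is the
Kerr–Schild slice `{t* = τ}`. DRSR arXiv:1402.7034, p. 51. [folklore] -/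
theorem hypHeight_eq_zero_of_radius_le {M a R₁ : ℝ} {y : E3} (hR : 0 ≤ R₁)
    (hy : radius a (E4.ofTimeSpace 0 y) ≤ R₁) : hypHeight M a R₁ y = 0 :=
  hypProfile_eq_zero_of_le hR hy

/-- `h_{R₁}` vanishes on the coordinate ball `{‖y‖ ≤ R₁}` (since `r ≤ ‖y‖`). DRSR
arXiv:1402.7034, p. 51. [folklore] -/
theorem hypHeight_eq_zero_of_norm_le {M a R₁ : ℝ} {y : E3} (hR : 0 ≤ R₁) (hy : ‖y‖ ≤ R₁) :
    hypHeight M a R₁ y = 0 :=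
  hypHeight_eq_zero_of_radius_le hR ((radius_ofTimeSpace_le_norm a 0 y).trans hy)

/-- `h_{R₁}` vanishes identically near any `y` with `r(0, y) < R₁` (the Kerr–Schild radius is
continuous). DRSR arXiv:1402.7034, p. 51. [folklore] -/
theorem hypHeight_eventuallyEq_zero {M a R₁ : ℝ} {y : E3} (hR : 0 ≤ R₁)
    (hy : radius a (E4.ofTimeSpace 0 y) < R₁) :
    hypHeight M a R₁ =ᶠ[𝓝 y] fun _ ↦ 0 := by
  have hopen : IsOpen {y' : E3 | radius a (E4.ofTimeSpace 0 y') < R₁} :=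
    isOpen_lt ((continuous_radius a).comp (E4.continuous_ofTimeSpace 0)) continuous_const
  filter_upwards [hopen.mem_nhds hy] with y' hy'
  exact hypHeight_eq_zero_of_radius_le hR (le_of_lt hy')

/-- The differential of `h_{R₁}` vanishes at any `y` with `r(0, y) < R₁`. DRSR arXiv:1402.7034,
p. 51. [folklore] -/
theorem fderiv_hypHeight_eq_zero {M a R₁ : ℝ} {y : E3} (hR : 0 ≤ R₁)
    (hy : radius a (E4.ofTimeSpace 0 y) < R₁) : fderiv ℝ (hypHeight M a R₁) y = 0 := by
  rw [(hypHeight_eventuallyEq_zero hR hy).fderiv_eq]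
  simp

/-! ### Cut-off radial profiles and graph height functions (generic in the far slope) -/

/-- The cut-off radial profile `k(r) = ∫_{R₁}^r χ((s − R₁)/R₁) σ(s) ds` with far slope `σ`
(`χ = Real.smoothTransition`): `k = 0` on `r ≤ R₁`, `k' = σ` on `r ≥ 2R₁`. The leaf
`{t*_KS = τ + k(r)}` is the Kerr–Schild slice on `{r ≤ R₁}` and has `t*_KS`-slope `σ(r)` far out.
DRSR arXiv:1402.7034, p. 51 ("a hyperboloidal hypersurface which agrees with `Σ₀` on `{r ≤ R}`
and which lies to the future of `Σ₀`"). [cite: DafermosRodnianskiShlapentokhrothman2014, §9 p. 51] -/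
def cutoffProfile (σ : ℝ → ℝ) (R₁ r : ℝ) : ℝ :=
  ∫ s in R₁..r, Real.smoothTransition ((s - R₁) / R₁) * σ s

/-- The graph height function `h(y) = k(r(0, y))` on the spatial coordinate space `E3` of the
Kerr–Schild chart attached to the cut-off profile with far slope `σ` (the Kerr–Schild radius
`r(0, y)` depends on `a`); the leaves are `Σ̃_τ(h) = {t* = τ + h(y)}`. DRSR arXiv:1402.7034, §3.3
and p. 51. [cite: DafermosRodnianskiShlapentokhrothman2014, §3.3 and p. 51] -/
def cutoffHeight (σ : ℝ → ℝ) (a R₁ : ℝ) (y : E3) : ℝ :=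
  cutoffProfile σ R₁ (radius a (E4.ofTimeSpace 0 y))

/-- The first version's profile is the cut-off profile with far slope `hypSlope M a`. [folklore] -/
theorem hypProfile_eq_cutoffProfile (M a R₁ r : ℝ) :
    hypProfile M a R₁ r = cutoffProfile (hypSlope M a) R₁ r :=
  rfl

/-- The first version's height is the cut-off height with far slope `hypSlope M a`. [folklore] -/
theorem hypHeight_eq_cutoffHeight (M a R₁ : ℝ) :
    hypHeight M a R₁ = cutoffHeight (hypSlope M a) a R₁ :=
  rfl

/-- `k(r) = 0` for `r ≤ R₁` (`0 ≤ R₁`): the cutoff `χ((s − R₁)/R₁)` vanishes on `s ≤ R₁`.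
DRSR arXiv:1402.7034, p. 51. [folklore] -/
theorem cutoffProfile_eq_zero_of_le {σ : ℝ → ℝ} {R₁ r : ℝ} (hR : 0 ≤ R₁) (hr : r ≤ R₁) :
    cutoffProfile σ R₁ r = 0 := by
  unfold cutoffProfile
  rw [intervalIntegral.integral_congr (g := fun _ ↦ (0 : ℝ)), intervalIntegral.integral_zero]
  intro s hs
  rw [Set.uIcc_of_ge hr] at hs
  have hs' : (s - R₁) / R₁ ≤ 0 := div_nonpos_of_nonpos_of_nonneg (by linarith [hs.2]) hR
  simp [Real.smoothTransition.zero_of_nonpos hs']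

/-- `h(y) = 0` whenever `r(0, y) ≤ R₁` (`0 ≤ R₁`): on `{r ≤ R₁}` the leaf `Σ̃_τ(h)` is the
Kerr–Schild slice `{t* = τ}`. DRSR arXiv:1402.7034, p. 51. [folklore] -/
theorem cutoffHeight_eq_zero_of_radius_le {σ : ℝ → ℝ} {a R₁ : ℝ} {y : E3} (hR : 0 ≤ R₁)
    (hy : radius a (E4.ofTimeSpace 0 y) ≤ R₁) : cutoffHeight σ a R₁ y = 0 :=
  cutoffProfile_eq_zero_of_le hR hy

/-- `h` vanishes on the coordinate ball `{‖y‖ ≤ R₁}` (since `r ≤ ‖y‖`). DRSR arXiv:1402.7034,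
p. 51. [folklore] -/
theorem cutoffHeight_eq_zero_of_norm_le {σ : ℝ → ℝ} {a R₁ : ℝ} {y : E3} (hR : 0 ≤ R₁)
    (hy : ‖y‖ ≤ R₁) : cutoffHeight σ a R₁ y = 0 :=
  cutoffHeight_eq_zero_of_radius_le hR ((radius_ofTimeSpace_le_norm a 0 y).trans hy)

/-- `h` vanishes identically near any `y` with `r(0, y) < R₁` (the Kerr–Schild radius is
continuous). DRSR arXiv:1402.7034, p. 51. [folklore] -/
theorem cutoffHeight_eventuallyEq_zero {σ : ℝ → ℝ} {a R₁ : ℝ} {y : E3} (hR : 0 ≤ R₁)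
    (hy : radius a (E4.ofTimeSpace 0 y) < R₁) :
    cutoffHeight σ a R₁ =ᶠ[𝓝 y] fun _ ↦ 0 := by
  have hopen : IsOpen {y' : E3 | radius a (E4.ofTimeSpace 0 y') < R₁} :=
    isOpen_lt ((continuous_radius a).comp (E4.continuous_ofTimeSpace 0)) continuous_const
  filter_upwards [hopen.mem_nhds hy] with y' hy'
  exact cutoffHeight_eq_zero_of_radius_le hR (le_of_lt hy')

/-- The differential of `h` vanishes at any `y` with `r(0, y) < R₁`. DRSR arXiv:1402.7034, p. 51.
[folklore] -/
theorem fderiv_cutoffHeight_eq_zero {σ : ℝ → ℝ} {a R₁ : ℝ} {y : E3} (hR : 0 ≤ R₁)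
    (hy : radius a (E4.ofTimeSpace 0 y) < R₁) : fderiv ℝ (cutoffHeight σ a R₁) y = 0 := by
  rw [(cutoffHeight_eventuallyEq_zero hR hy).fderiv_eq]
  simp

/-! ### The hyperboloidal foliation `Σ̃_τ(h♯_{R₁})` terminating at `𝓘⁺` -/

/-- The `t*_KS`-slope `σ♯(s) = r*'(s) + 2M/s = (s² + a²)/Δ(s) + 2M/s`, `Δ = (s − r₊)(s − r₋)`, of a
hyperboloidal profile **terminating at future null infinity**: since `dt*_KS = dt + (r*' − 1) dr`,
the leaf is `{t = r + 2M log r + c}` far out in Boyer–Lindquist time, and it lags behind the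
outgoing null cones `{t − r* = u}` (`dr*/dr = (r² + a²)/Δ`, DRSR arXiv:1402.7034, §2.1.2 (2);
`r* = r + 2M log r + O(1)`) at the integrable rate `r*' − 1 − 2M/r = 2M(2Mr − a²)/(rΔ) ∼ 4M²/r²`,
so that `u` has a finite limit along the leaf, which is spacelike for `r ≥ R₀(M, a)` (module
docstring, *The corrected foliation*). This is the hypothesis "asymptotically hyperboloidal
hypersurface terminating at null infinity" of DRSR Cor. 3.1 (arXiv:1402.7034, §3.3), cf. the
tortoise normalisation `t* = t + 2M log(r − 2M)` of arXiv:0811.0354, §2.2; contrast `hypSlope`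
(`M/s`, leaves reaching `i⁰`). Junk where `Δ = 0` or `s = 0` (never used: only `s ≥ R₁ > r₊`). [cite: DafermosRodnianskiShlapentokhrothman2014, §3.3 (Cor. 3.1) and §2.1.2 (2)] -/
def scriSlope (M a s : ℝ) : ℝ :=
  (s ^ 2 + a ^ 2) / ((s - rPlus M a) * (s - rMinus M a)) + 2 * M / s

/-- `Δ(s) = (s − r₊)(s − r₋) = s² − 2Ms + a²` for `a² ≤ M²` (`r± = M ± √(M² − a²)`). DRSR
arXiv:1402.7034, §2.1.1. [cite: DafermosRodnianskiShlapentokhrothman2014, §2.1.1] -/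
theorem sub_rPlus_mul_sub_rMinus {M a : ℝ} (h : a ^ 2 ≤ M ^ 2) (s : ℝ) :
    (s - rPlus M a) * (s - rMinus M a) = s ^ 2 - 2 * M * s + a ^ 2 := by
  have hsq : √(M ^ 2 - a ^ 2) ^ 2 = M ^ 2 - a ^ 2 := Real.sq_sqrt (by linarith)
  calc (s - rPlus M a) * (s - rMinus M a) = (s - M) ^ 2 - √(M ^ 2 - a ^ 2) ^ 2 := by
        simp only [rPlus, rMinus]; ring
    _ = s ^ 2 - 2 * M * s + a ^ 2 := by rw [hsq]; ring

/-- The first version's slope is `σ♯ − M/s`: its leaves fall behind those of `scriSlope` (and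
behind the outgoing null cones) at the non-integrable rate `M/s`, whence `u → −∞` along them
(erratum in the module docstring). [folklore] -/
theorem hypSlope_eq_scriSlope_sub (M a s : ℝ) : hypSlope M a s = scriSlope M a s - M / s := by
  simp only [hypSlope, scriSlope]
  ring

/-- **The leaves of `scriSlope` lag behind the outgoing null cones at an integrable rate.** In
the `(t*_KS, r)`-plane the outgoing principal null directions have slope `2r*' − 1`
(`t*_KS = t + r* − r = u + 2r* − r` along `{t − r* = u}`), and
`(2r*'(s) − 1) − σ♯(s) = r*'(s) − 1 − 2M/s = 2M(2Ms − a²)/(s Δ(s))`, which is positive for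
`s > r₊` (`2Ms − a² > 2Mr₊ − a² = r₊² > 0`) and `O(s⁻²)`: the retarded time `u = t − r*`
converges along the leaf, which therefore terminates at `𝓘⁺`, approaching the cone `{u = u_∞}`.
(For `hypSlope` the lag is `M/s + 2M(2Ms − a²)/(sΔ)`, not integrable: `u → −∞`, the leaf reaches
`i⁰`.) The algebraic identity behind the erratum and *The corrected foliation* in the module
docstring; `dr*/dr = (r² + a²)/Δ` is DRSR arXiv:1402.7034, §2.1.2 (2). [folklore] -/
theorem outgoingNullSlope_sub_scriSlope {M a s : ℝ} (h : a ^ 2 ≤ M ^ 2)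
    (hΔ : (s - rPlus M a) * (s - rMinus M a) ≠ 0) (hs : s ≠ 0) :
    2 * ((s ^ 2 + a ^ 2) / ((s - rPlus M a) * (s - rMinus M a))) - 1 - scriSlope M a s =
      2 * M * (2 * M * s - a ^ 2) / (s * ((s - rPlus M a) * (s - rMinus M a))) := by
  have key : ∀ D : ℝ, D ≠ 0 → D = s ^ 2 - 2 * M * s + a ^ 2 →
      2 * ((s ^ 2 + a ^ 2) / D) - 1 - ((s ^ 2 + a ^ 2) / D + 2 * M / s) =
        2 * M * (2 * M * s - a ^ 2) / (s * D) := by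
    intro D hD0 hDeq
    field_simp
    rw [hDeq]
    ring
  exact key _ hΔ (sub_rPlus_mul_sub_rMinus h s)

/-! ### Terminating at `𝓘⁺` versus reaching `i⁰`: (non-)integrability of the lag

Along a graph leaf `{t*_KS = τ + k(r)}` the retarded time `u = t − r* = t*_KS − 2r* + r + c`
satisfies `du/dr = k'(r) − (2r*'(r) − 1) = −(lag)`; by Moschidis's definition (arXiv:1509.08489,
Def. 3.2) the leaf terminates at `𝓘⁺` iff `u` stays bounded along it, i.e. iff the lag
`(2r*' − 1) − k'` is integrable at infinity. For the corrected far slope `k' = σ♯ = scriSlope` the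
lag is `2M(2Ms − a²)/(sΔ) = O(s⁻²)`, integrable (`integrableOn_outgoingNullSlope_sub_scriSlope`);
for the first version's `k' = hypSlope = σ♯ − M/s` it is `M/s + O(s⁻²)`, not integrable
(`not_integrableOn_outgoingNullSlope_sub_hypSlope`): this is the dichotomy behind the erratum,
machine-checked. -/

/-- `a² < M²` for subextremal parameters (O'Neill 1995, Ch. 2, §2.3). [cite: ONeill1995, Ch. 2  §2.3] -/
theorem IsSubextremal.sq_lt_sq {M a : ℝ} (h : IsSubextremal M a) : a ^ 2 < M ^ 2 :=
  sq_lt_sq' (abs_lt.1 h).1 (abs_lt.1 h).2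

/-- `M < r₊` for subextremal parameters (`r₊ = M + √(M² − a²)`; O'Neill 1995, Ch. 2, §2.3). [cite: ONeill1995, Ch. 2  §2.3] -/
theorem IsSubextremal.M_lt_rPlus {M a : ℝ} (h : IsSubextremal M a) : M < rPlus M a := by
  have hs := Real.sqrt_pos.2 (sub_pos.2 h.sq_lt_sq)
  unfold rPlus
  linarith

/-- `0 < r₊` for subextremal parameters (O'Neill 1995, Ch. 2, §2.3). [cite: ONeill1995, Ch. 2  §2.3] -/
theorem IsSubextremal.rPlus_pos {M a : ℝ} (h : IsSubextremal M a) : 0 < rPlus M a :=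
  h.pos.trans h.M_lt_rPlus

/-- `Δ(r₊) = 0`, i.e. `r₊² = 2M r₊ − a²` (DRSR arXiv:1402.7034, §2.1.1). [cite: DafermosRodnianskiShlapentokhrothman2014, §2.1.1] -/
theorem IsSubextremal.rPlus_sq {M a : ℝ} (h : IsSubextremal M a) :
    rPlus M a ^ 2 = 2 * M * rPlus M a - a ^ 2 := by
  have h0 := sub_rPlus_mul_sub_rMinus h.sq_lt_sq.le (rPlus M a)
  rw [sub_self, zero_mul] at h0
  linarith

/-- `Δ(s) = (s − r₊)(s − r₋) > 0` for `s > r₊` (DRSR arXiv:1402.7034, §2.1.1). [folklore] -/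
theorem sub_rPlus_mul_sub_rMinus_pos {M a s : ℝ} (hs : rPlus M a < s) :
    0 < (s - rPlus M a) * (s - rMinus M a) :=
  mul_pos (sub_pos.2 hs) (sub_pos.2 ((rMinus_le_rPlus M a).trans_lt hs))

/-- `(s − r₊)² ≤ Δ(s)` for `s > r₊` (since `r₋ ≤ r₊`). [folklore] -/
theorem sq_sub_rPlus_le {M a s : ℝ} (hs : rPlus M a < s) :
    (s - rPlus M a) ^ 2 ≤ (s - rPlus M a) * (s - rMinus M a) := by
  have h1 : 0 ≤ s - rPlus M a := (sub_pos.2 hs).le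
  have h2 : s - rPlus M a ≤ s - rMinus M a := by linarith [rMinus_le_rPlus M a]
  rw [sq]
  exact mul_le_mul_of_nonneg_left h2 h1

/-- The lag of the `scriSlope` leaves behind the outgoing null cones in closed form on the
exterior `s > r₊` (there `Δ ≠ 0`, `s ≠ 0`). [folklore] -/
theorem outgoingNullSlope_sub_scriSlope_of_lt {M a s : ℝ} (h : IsSubextremal M a)
    (hs : rPlus M a < s) :
    2 * ((s ^ 2 + a ^ 2) / ((s - rPlus M a) * (s - rMinus M a))) - 1 - scriSlope M a s =
      2 * M * (2 * M * s - a ^ 2) / (s * ((s - rPlus M a) * (s - rMinus M a))) :=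
  outgoingNullSlope_sub_scriSlope h.sq_lt_sq.le (sub_rPlus_mul_sub_rMinus_pos hs).ne'
    (h.rPlus_pos.trans hs).ne'

/-- The lag is positive on the exterior: `2Ms − a² > 2Mr₊ − a² = r₊² > 0` for `s > r₊`
(the leaves of `scriSlope` are less steep than the outgoing null cones, as spacelike leaves must
be). [folklore] -/
theorem outgoingNullSlope_sub_scriSlope_pos {M a s : ℝ} (h : IsSubextremal M a)
    (hs : rPlus M a < s) :
    0 < 2 * M * (2 * M * s - a ^ 2) / (s * ((s - rPlus M a) * (s - rMinus M a))) := by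
  have hM := h.pos
  have hr := h.rPlus_pos
  have hsq := h.rPlus_sq
  have hnum : 0 < 2 * M * s - a ^ 2 := by nlinarith
  have hs0 : 0 < s := hr.trans hs
  have hΔ := sub_rPlus_mul_sub_rMinus_pos hs
  positivity

/-- The lag is `O(s⁻²)`: `2M(2Ms − a²)/(sΔ) ≤ 4M²/(s − r₊)²` for `s > r₊`
(`2M(2Ms − a²) ≤ 4M²s` and `Δ ≥ (s − r₊)²`). [folklore] -/
theorem outgoingNullSlope_sub_scriSlope_le {M a s : ℝ} (h : IsSubextremal M a)
    (hs : rPlus M a < s) :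
    2 * M * (2 * M * s - a ^ 2) / (s * ((s - rPlus M a) * (s - rMinus M a))) ≤
      4 * M ^ 2 / (s - rPlus M a) ^ 2 := by
  have hM := h.pos
  have hs0 : 0 < s := h.rPlus_pos.trans hs
  have hΔ := sub_rPlus_mul_sub_rMinus_pos hs
  have hsq : 0 < (s - rPlus M a) ^ 2 := pow_pos (sub_pos.2 hs) 2
  rw [div_le_div_iff₀ (mul_pos hs0 hΔ) hsq]
  have h1 : 2 * M * (2 * M * s - a ^ 2) ≤ 4 * M ^ 2 * s := by nlinarith [sq_nonneg a]
  have h2 := sq_sub_rPlus_le (M := M) (a := a) hs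
  calc 2 * M * (2 * M * s - a ^ 2) * (s - rPlus M a) ^ 2
      ≤ 4 * M ^ 2 * s * (s - rPlus M a) ^ 2 := by gcongr
    _ ≤ 4 * M ^ 2 * s * ((s - rPlus M a) * (s - rMinus M a)) := by gcongr
    _ = 4 * M ^ 2 * (s * ((s - rPlus M a) * (s - rMinus M a))) := by ring

/-- `s ↦ c/(s − r)²` is integrable on `[R, ∞)` for `R > r`, `c ≥ 0` (it is the derivative of
`−c/(s − r) → 0`). [folklore] -/
theorem integrableOn_const_div_sq_sub {c r R : ℝ} (hR : r < R) (hc : 0 ≤ c) :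
    IntegrableOn (fun s : ℝ ↦ c / (s - r) ^ 2) (Ici R) := by
  rw [integrableOn_Ici_iff_integrableOn_Ioi]
  have hderiv : ∀ x ∈ Ioi R, HasDerivAt (fun s : ℝ ↦ -c * (s - r)⁻¹) (c / (x - r) ^ 2) x := by
    intro x hx
    have hx0 : x - r ≠ 0 := (sub_pos.2 (hR.trans hx)).ne'
    have h1 : HasDerivAt (fun s : ℝ ↦ -c * (s - r)⁻¹) (-c * (-(1 : ℝ) / (x - r) ^ 2)) x :=
      (((hasDerivAt_id x).sub_const r).inv hx0).const_mul (-c)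
    convert h1 using 1
    field_simp
  refine integrableOn_Ioi_deriv_of_nonneg (g := fun s : ℝ ↦ -c * (s - r)⁻¹) (l := 0) ?_ hderiv
    (fun x hx ↦ by positivity) ?_
  · have hx0 : R - r ≠ 0 := (sub_pos.2 hR).ne'
    exact ((continuousAt_id.sub continuousAt_const).inv₀ hx0 |>.const_mul (-c)).continuousWithinAt
  · have : Tendsto (fun s : ℝ ↦ (s - r)⁻¹) atTop (𝓝 0) :=
      tendsto_inv_atTop_zero.comp (tendsto_atTop_add_const_right _ _ tendsto_id)
    simpa using this.const_mul (-c)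

/-- **The corrected leaves terminate at `𝓘⁺`.** The lag `(2r*' − 1) − σ♯` of the `scriSlope`
leaves behind the outgoing null cones is integrable on `[R, ∞)` for every `R > r₊`; hence
`u = u(R) − ∫_R^r lag` is bounded (indeed convergent) along the leaf, which terminates at `𝓘⁺` in
the sense of Moschidis, arXiv:1509.08489, Def. 3.2. [cite: Moschidis2016, Def. 3.2] -/
theorem integrableOn_outgoingNullSlope_sub_scriSlope {M a R : ℝ} (h : IsSubextremal M a)
    (hR : rPlus M a < R) :
    IntegrableOn (fun s : ℝ ↦ 2 * ((s ^ 2 + a ^ 2) / ((s - rPlus M a) * (s - rMinus M a))) - 1 -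
      scriSlope M a s) (Ici R) := by
  have hM := h.pos
  have heq : EqOn (fun s : ℝ ↦ 2 * M * (2 * M * s - a ^ 2) / (s * ((s - rPlus M a) *
      (s - rMinus M a)))) (fun s : ℝ ↦ 2 * ((s ^ 2 + a ^ 2) / ((s - rPlus M a) *
      (s - rMinus M a))) - 1 - scriSlope M a s) (Ici R) := fun s hs ↦
    (outgoingNullSlope_sub_scriSlope_of_lt h (hR.trans_le hs)).symm
  refine IntegrableOn.congr_fun ?_ heq measurableSet_Ici
  refine Integrable.mono' (integrableOn_const_div_sq_sub hR (by positivity : (0:ℝ) ≤ 4 * M ^ 2))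
    ?_ ?_
  · refine ContinuousOn.aestronglyMeasurable (fun s hs ↦ ?_) measurableSet_Ici
    have hs' : rPlus M a < s := hR.trans_le hs
    have hs0 : s ≠ 0 := (h.rPlus_pos.trans hs').ne'
    have hΔ : s * ((s - rPlus M a) * (s - rMinus M a)) ≠ 0 :=
      mul_ne_zero hs0 (sub_rPlus_mul_sub_rMinus_pos hs').ne'
    have hc : ContinuousAt (fun s : ℝ ↦ 2 * M * (2 * M * s - a ^ 2) / (s * ((s - rPlus M a) *
        (s - rMinus M a)))) s := by fun_prop (disch := exact hΔ)
    exact hc.continuousWithinAt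
  · refine (ae_restrict_mem measurableSet_Ici).mono fun s hs ↦ ?_
    have hs' : rPlus M a < s := hR.trans_le hs
    rw [Real.norm_of_nonneg (outgoingNullSlope_sub_scriSlope_pos h hs').le]
    exact outgoingNullSlope_sub_scriSlope_le h hs'

/-- **The first version's leaves reach `i⁰`.** The lag `(2r*' − 1) − hypSlope = lag♯ + M/s` of the
leaves built on the prototype `Σ₂` as printed in arXiv:1010.5132, §4.4 is *not* integrable on any
`[R, ∞)`, `R > r₊` (Mathlib's `not_integrableOn_Ici_inv`); hence `u = u(R) − ∫_R^r lag → −∞`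
along those leaves, which do not terminate at `𝓘⁺` (Moschidis, arXiv:1509.08489, Def. 3.2) —
the erratum of the module docstring. [cite: Moschidis2016, Def. 3.2] -/
theorem not_integrableOn_outgoingNullSlope_sub_hypSlope {M a R : ℝ} (h : IsSubextremal M a)
    (hR : rPlus M a < R) :
    ¬ IntegrableOn (fun s : ℝ ↦ 2 * ((s ^ 2 + a ^ 2) / ((s - rPlus M a) * (s - rMinus M a))) -
      1 - hypSlope M a s) (Ici R) := by
  intro hint
  have hM := h.pos
  have hdiff := hint.sub (integrableOn_outgoingNullSlope_sub_scriSlope h hR)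
  have heq : EqOn (fun s : ℝ ↦ M * s⁻¹) ((fun s : ℝ ↦ 2 * ((s ^ 2 + a ^ 2) /
      ((s - rPlus M a) * (s - rMinus M a))) - 1 - hypSlope M a s) - fun s : ℝ ↦
      2 * ((s ^ 2 + a ^ 2) / ((s - rPlus M a) * (s - rMinus M a))) - 1 - scriSlope M a s)
      (Ici R) := by
    intro s _
    simp only [Pi.sub_apply, hypSlope_eq_scriSlope_sub]
    ring
  have hinv : IntegrableOn (fun s : ℝ ↦ M * s⁻¹) (Ici R) :=
    hdiff.congr_fun heq.symm measurableSet_Ici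
  have hinv' : IntegrableOn (fun s : ℝ ↦ M⁻¹ * (M * s⁻¹)) (Ici R) := hinv.const_mul M⁻¹
  refine not_integrableOn_Ici_inv (a := R) (hinv'.congr_fun (fun s _ ↦ ?_) measurableSet_Ici)
  simp [hM.ne']

/-! ### The profile and height of the corrected foliation -/

/-- The radial profile `k♯_{R₁} = cutoffProfile (scriSlope M a) R₁` of the hyperboloidal height
terminating at `𝓘⁺`: `k♯_{R₁} = 0` on `r ≤ R₁`, slope `σ♯` on `r ≥ 2R₁`. DRSR arXiv:1402.7034,
§3.3 and p. 51. [cite: DafermosRodnianskiShlapentokhrothman2014, §3.3 and p. 51] -/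
def scriProfile (M a R₁ r : ℝ) : ℝ :=
  cutoffProfile (scriSlope M a) R₁ r

/-- The **hyperboloidal height function terminating at `𝓘⁺`**, `h♯_{R₁}(y) = k♯_{R₁}(r(0, y))`
(`= cutoffHeight (scriSlope M a) a R₁`); the leaves `Σ̃_τ(h♯_{R₁}) = {t*_KS = τ + h♯_{R₁}(y)}`
are the Kerr–Schild slices on `{r ≤ R₁}` and smooth spacelike hypersurfaces transversal to `𝓗⁺`
terminating at `𝓘⁺` (module docstring), `Σ̃_τ = φ_τ Σ̃₀`. DRSR arXiv:1402.7034, §3.3 (Cor. 3.1)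
and p. 51; Moschidis arXiv:1509.08489, §1.3.3. [cite: DafermosRodnianskiShlapentokhrothman2014, §3.3 and p. 51] -/
def scriHeight (M a R₁ : ℝ) (y : E3) : ℝ :=
  cutoffHeight (scriSlope M a) a R₁ y

/-- `h♯_{R₁}` is the cut-off height with far slope `scriSlope M a` (definitional). [folklore] -/
theorem scriHeight_eq_cutoffHeight (M a R₁ : ℝ) :
    scriHeight M a R₁ = cutoffHeight (scriSlope M a) a R₁ :=
  rfl

/-- `h♯_{R₁}(y) = 0` whenever `r(0, y) ≤ R₁` (`0 ≤ R₁`). DRSR arXiv:1402.7034, p. 51. [folklore] -/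
theorem scriHeight_eq_zero_of_radius_le {M a R₁ : ℝ} {y : E3} (hR : 0 ≤ R₁)
    (hy : radius a (E4.ofTimeSpace 0 y) ≤ R₁) : scriHeight M a R₁ y = 0 :=
  cutoffHeight_eq_zero_of_radius_le hR hy

/-- `h♯_{R₁}` vanishes on the coordinate ball `{‖y‖ ≤ R₁}`. DRSR arXiv:1402.7034, p. 51. [folklore] -/
theorem scriHeight_eq_zero_of_norm_le {M a R₁ : ℝ} {y : E3} (hR : 0 ≤ R₁) (hy : ‖y‖ ≤ R₁) :
    scriHeight M a R₁ y = 0 :=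
  cutoffHeight_eq_zero_of_norm_le hR hy

/-- The differential of `h♯_{R₁}` vanishes at any `y` with `r(0, y) < R₁`. DRSR arXiv:1402.7034,
p. 51. [folklore] -/
theorem fderiv_scriHeight_eq_zero {M a R₁ : ℝ} {y : E3} (hR : 0 ≤ R₁)
    (hy : radius a (E4.ofTimeSpace 0 y) < R₁) : fderiv ℝ (scriHeight M a R₁) y = 0 :=
  fderiv_cutoffHeight_eq_zero hR hy

/-! ### Graph leaves, their conormal and normal, and the flux of `J^V` -/

/-- The point of the leaf `Σ̃_τ(h) = {t* = τ + h(y)}` over `y ∈ E3`: `(τ + h y, y) ∈ E4`.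
`Σ̃_τ(h) = φ_τ(Σ̃₀(h))` for the `t*`-translation `φ_τ`. DRSR arXiv:1402.7034, §3.3. [cite: DafermosRodnianskiShlapentokhrothman2014, §3.3] -/
def leafPoint (h : E3 → ℝ) (τ : ℝ) (y : E3) : E4 :=
  E4.ofTimeSpace (τ + h y) y

/-- For `h y = 0` the leaf point is the point `(τ, y)` of the Kerr–Schild slice. DRSR
arXiv:1402.7034, p. 51. [folklore] -/
@[simp]
theorem leafPoint_of_eq_zero {h : E3 → ℝ} {y : E3} (hy : h y = 0) (τ : ℝ) :
    leafPoint h τ y = E4.ofTimeSpace τ y := by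
  simp [leafPoint, hy]

/-- The **conormal** of the leaves of the height-`h` foliation at `x ∈ E4`: the covector
`d(t* − h ∘ spatial)_x = dt* − dh_{x⃗} ∘ spatial` (the same for all leaves through the
`t*`-line over `x⃗`, by stationarity). Dafermos–Rodnianski arXiv:1010.5132, §4.2, §4.4. [cite: DafermosRodnianski2010KerrSmallA, §4.2] -/
def leafConormal (h : E3 → ℝ) (x : E4) : E4 →ₗ[ℝ] ℝ :=
  ((E4.dx 0 : E4 →L[ℝ] ℝ) - (fderiv ℝ h (E4.spatial x)).comp E4.spatial : E4 →L[ℝ] ℝ)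

/-- Unfolding lemma: `d(t* − h∘spatial)_x (v) = v⁰ − dh_{x⃗}(v⃗)`. Dafermos–Rodnianski
arXiv:1010.5132, §4.2. [folklore] -/
@[simp]
theorem leafConormal_apply (h : E3 → ℝ) (x v : E4) :
    leafConormal h x v = v 0 - fderiv ℝ h (E4.spatial x) (E4.spatial v) := by
  simp [leafConormal]

/-- Where `dh = 0` the conormal is `dt*`. Dafermos–Rodnianski arXiv:1010.5132, §4.2. [folklore] -/
theorem leafConormal_of_fderiv_eq_zero {h : E3 → ℝ} {x : E4} (hx : fderiv ℝ h (E4.spatial x) = 0) :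
    leafConormal h x = ((E4.dx 0 : E4 →L[ℝ] ℝ) : E4 →ₗ[ℝ] ℝ) := by
  ext v
  simp [hx]

/-- `g♯(dt*) = −V` for the Kerr–Schild field `V = Kerr.timeVector = −g♯dt*` (from
`g(V, w) = −w⁰`, `Kerr.bilin_timeVector`, and the musical isomorphisms of the prelude).
Dafermos–Rodnianski, arXiv:0811.0354, §5.1. [cite: DafermosRodnianski2008, §5.1] -/
theorem sharp_dx_zero [Facts] (M a r₀ : ℝ) (x : region a r₀) :
    (smoothMetric M a r₀).sharp x ((E4.dx 0 : E4 →L[ℝ] ℝ) : E4 →ₗ[ℝ] ℝ) = -timeVector M a x.1 := by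
  have hflat : (smoothMetric M a r₀).flat x (-timeVector M a x.1) =
      ((E4.dx 0 : E4 →L[ℝ] ℝ) : E4 →ₗ[ℝ] ℝ) := by
    apply LinearMap.ext
    intro w
    rw [PseudoRiemannianMetric.flat_apply]
    change bilin M a x.1 (-timeVector M a x.1) w = E4.dx 0 w
    rw [map_neg, neg_apply, bilin_timeVector (radius_pos_of_mem_region x.2)]
    simp
  rw [← hflat, PseudoRiemannianMetric.sharp_flat]

/-- `g♯(dt*) = −V` on the exterior chart `{r > r₊}` (the case `r₀ = r₊` of `sharp_dx_zero`).
Dafermos–Rodnianski, arXiv:0811.0354, §5.1. [cite: DafermosRodnianski2008, §5.1] -/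
theorem sharp_dx_zero_exterior [Facts] (M a : ℝ) (x : region a (rPlus M a)) :
    (smoothMetric M a (rPlus M a)).sharp x ((E4.dx 0 : E4 →L[ℝ] ℝ) : E4 →ₗ[ℝ] ℝ) =
      -timeVector M a x.1 :=
  sharp_dx_zero M a (rPlus M a) x

/-- The (un-normalised) **future normal** of the leaf through `x`: `W = −g♯ d(t* − h∘spatial)`.
With `n = W/|W|_g` the future unit normal and `dσ` the induced volume, `J_μ n^μ dσ = J(W) dy`
on the leaf parametrised by `y` (Kerr–Schild coordinates have `√|det g| = 1`; module docstring).
Dafermos–Rodnianski arXiv:1010.5132, §4.2; DRSR arXiv:1402.7034, §3.3. [cite: DafermosRodnianski2010KerrSmallA, §4.2] -/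
def leafNormal [Facts] (M a : ℝ) (h : E3 → ℝ) (x : region a (rPlus M a)) : E4 :=
  -(smoothMetric M a (rPlus M a)).sharp x (leafConormal h x.1)

/-- Where `dh = 0` (in particular on `{r < R₁}` for `h = h_{R₁}`) the leaf normal is the
Kerr–Schild field `V = −g♯dt*`. Dafermos–Rodnianski, arXiv:0811.0354, §5.1. [cite: DafermosRodnianski2008, §5.1] -/
theorem leafNormal_eq_timeVector [Facts] {M a : ℝ} {h : E3 → ℝ} (x : region a (rPlus M a))
    (hx : fderiv ℝ h (E4.spatial x.1) = 0) : leafNormal M a h x = timeVector M a x.1 := by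
  rw [leafNormal, leafConormal_of_fderiv_eq_zero hx, sharp_dx_zero_exterior]
  exact neg_neg _

open scoped Classical in
/-- The **flux density** of the current `J^V[ψ]` through the leaf `Σ̃_τ(h)` over `y ∈ E3`:
`T[ψ](V, W)` at the leaf point `(τ + h y, y)`, `W = −g♯d(t* − h)` (`leafNormal`), as an
extended non-negative real, and `0` if the leaf point is not in the exterior `{r > r₊}`. This is
`J^V_μ[ψ] n^μ_{Σ̃_τ} dσ/dy` (module docstring). DRSR arXiv:1402.7034, §3.1, §3.3;
Dafermos–Rodnianski arXiv:1010.5132, §4.2. [cite: DafermosRodnianskiShlapentokhrothman2014, §3.3] -/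
def leafFluxDensity [Facts] (M a : ℝ) (h : E3 → ℝ) (ψ : region a (rPlus M a) → ℝ) (τ : ℝ) (y : E3) :
    ℝ≥0∞ :=
  if hy : leafPoint h τ y ∈ region a (rPlus M a) then
    ENNReal.ofReal
      ((smoothMetric M a (rPlus M a)).stressEnergy ψ ⟨leafPoint h τ y, hy⟩
        (timeVector M a (leafPoint h τ y)) (leafNormal M a h ⟨leafPoint h τ y, hy⟩))
  else 0

/-- The **energy flux** `∫_{Σ̃_τ(h)} J^V_μ[ψ] n^μ dσ = ∫_{E3} T[ψ](V, −g♯d(t* − h))(τ + h y, y) dy`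
of the wave `ψ` through the leaf `Σ̃_τ(h)` of the height-`h` foliation of the Kerr exterior
(Lebesgue integral on `E3`; `ℝ≥0∞`-valued, finiteness is part of the statements). DRSR
arXiv:1402.7034, Thm. 3.1 (23) and Cor. 3.1 (the quantities `∫_{Σ̃_τ} J^N_μ[ψ] n^μ_{Σ̃_τ}`, with
`N` replaced by `V`, module docstring). [cite: DafermosRodnianskiShlapentokhrothman2014, §3.3 Cor. 3.1] -/
def leafFlux [Facts] (M a : ℝ) (h : E3 → ℝ) (ψ : region a (rPlus M a) → ℝ) (τ : ℝ) : ℝ≥0∞ :=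
  ∫⁻ y : E3, leafFluxDensity M a h ψ τ y

/-- Unfolding lemma for the flux density at a leaf point of the exterior. DRSR
arXiv:1402.7034, §3.3. [folklore] -/
theorem leafFluxDensity_of_mem [Facts] {M a : ℝ} (h : E3 → ℝ) (ψ : region a (rPlus M a) → ℝ) (τ : ℝ)
    {y : E3} (hy : leafPoint h τ y ∈ region a (rPlus M a)) :
    leafFluxDensity M a h ψ τ y =
      ENNReal.ofReal
        ((smoothMetric M a (rPlus M a)).stressEnergy ψ ⟨leafPoint h τ y, hy⟩
          (timeVector M a (leafPoint h τ y)) (leafNormal M a h ⟨leafPoint h τ y, hy⟩)) := by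
  simp [leafFluxDensity, hy]

/-- Off the exterior the flux density is `0`. DRSR arXiv:1402.7034, §3.3. [folklore] -/
theorem leafFluxDensity_of_not_mem [Facts] {M a : ℝ} (h : E3 → ℝ) (ψ : region a (rPlus M a) → ℝ)
    (τ : ℝ) {y : E3} (hy : leafPoint h τ y ∉ region a (rPlus M a)) :
    leafFluxDensity M a h ψ τ y = 0 := by
  simp [leafFluxDensity, hy]

/-- The flux of the zero field vanishes (`T[0] = 0`). DRSR arXiv:1402.7034, §3.3. [folklore] -/
theorem leafFlux_zero [Facts] (M a : ℝ) (h : E3 → ℝ) (τ : ℝ) :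
    leafFlux M a h (fun _ ↦ 0) τ = 0 := by
  have : leafFluxDensity M a h (fun _ : region a (rPlus M a) ↦ (0 : ℝ)) τ = fun _ ↦ 0 := by
    funext y
    by_cases hy : leafPoint h τ y ∈ region a (rPlus M a)
    · rw [leafFluxDensity_of_mem h _ τ hy, (smoothMetric M a (rPlus M a)).stressEnergy_const]
      simp
    · exact leafFluxDensity_of_not_mem h _ τ hy
  simp [leafFlux, this]

/-! ### The explicit inverse Kerr–Schild metric and the coercivity of `T[ψ](V, V)` -/

/-- A linear functional on `E4` is determined by its values on the coordinate vectors: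
`p(w) = ∑_μ w^μ p(∂_μ)`. Coordinate bookkeeping (Dafermos–Rodnianski, arXiv:0811.0354, §5.1). [folklore] -/
theorem _root_.Literature.Geometry.Lorentzian.E4.linearMap_apply_eq_sum (p : E4 →ₗ[ℝ] ℝ) (w : E4) :
    p w = ∑ μ : Fin 4, w μ * p (E4.basisVector μ) := by
  conv_lhs => rw [← (EuclideanSpace.basisFun (Fin 4) ℝ).sum_repr w]
  simp only [map_sum, map_smul, smul_eq_mul, EuclideanSpace.basisFun_apply,
    EuclideanSpace.basisFun_repr]

/-- `Fin.succ 2 = 3` in `Fin 4` (index bookkeeping for the spatial coordinates). [folklore] -/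
theorem fin_succ_two_eq_three : (Fin.succ 2 : Fin 4) = 3 := rfl

/-- The Minkowski dual vector `η♯p = η⁻¹p = (−p₀, p₁, p₂, p₃)` of a covector `p`, `p_μ = p(∂_μ)`
(`η⁻¹ = η` in inertial coordinates). O'Neill 1983, Ch. 3, p. 60 (metrically equivalent vectors
and covectors). [cite: ONeillSemiRiemannian1983, Ch. 3 p. 60] -/
def etaSharp (p : E4 →ₗ[ℝ] ℝ) : E4 :=
  WithLp.toLp 2 fun μ ↦ if μ = 0 then -p (E4.basisVector 0) else p (E4.basisVector μ)

/-- Time component of `η♯p`: `−p₀`. O'Neill 1983, Ch. 3, p. 60. [folklore] -/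
@[simp]
theorem etaSharp_apply_zero (p : E4 →ₗ[ℝ] ℝ) : etaSharp p 0 = -p (E4.basisVector 0) := by
  simp [etaSharp]

/-- First spatial component of `η♯p`: `p₁`. O'Neill 1983, Ch. 3, p. 60. [folklore] -/
@[simp]
theorem etaSharp_apply_one (p : E4 →ₗ[ℝ] ℝ) : etaSharp p 1 = p (E4.basisVector 1) := by
  simp [etaSharp]

/-- Second spatial component of `η♯p`: `p₂`. O'Neill 1983, Ch. 3, p. 60. [folklore] -/
@[simp]
theorem etaSharp_apply_two (p : E4 →ₗ[ℝ] ℝ) : etaSharp p 2 = p (E4.basisVector 2) := by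
  simp [etaSharp]

/-- Third spatial component of `η♯p`: `p₃`. O'Neill 1983, Ch. 3, p. 60. [folklore] -/
@[simp]
theorem etaSharp_apply_three (p : E4 →ₗ[ℝ] ℝ) : etaSharp p 3 = p (E4.basisVector 3) := by
  simp [etaSharp]

/-- `η(η♯p, w) = p(w)`: `η♯` is the inverse of `η♭`. O'Neill 1983, Ch. 3, p. 60. [cite: ONeillSemiRiemannian1983, Ch. 3 p. 60] -/
theorem _root_.Literature.Geometry.Lorentzian.Minkowski.bilin_etaSharp (p : E4 →ₗ[ℝ] ℝ) (w : E4) :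
    Minkowski.bilin (etaSharp p) w = p w := by
  rw [E4.linearMap_apply_eq_sum p w, Minkowski.bilin_apply, Fin.sum_univ_four,
    Fin.sum_univ_three]
  simp only [Fin.succ_zero_eq_one, Fin.succ_one_eq_two, fin_succ_two_eq_three,
    etaSharp_apply_zero, etaSharp_apply_one, etaSharp_apply_two, etaSharp_apply_three]
  ring

/-- `ℓ(η♯p) = p(ℓ♯)` for the Kerr–Schild null covector `ℓ` and its `η`-dual `ℓ♯`
(Kerr–Schild 1965; both sides equal `η(ℓ♯, η♯p)`). [cite: KerrSchild1965, §2] -/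
theorem nullCovector_etaSharp (a : ℝ) (x : E4) (p : E4 →ₗ[ℝ] ℝ) :
    nullCovector a x (etaSharp p) = p (nullVector a x) := by
  rw [← bilin_nullVector, Minkowski.bilin_symm, Minkowski.bilin_etaSharp]

/-- The **explicit inverse Kerr–Schild metric** on covectors:
`g♯p = η♯p − 2H p(ℓ♯) ℓ♯`, i.e. `g⁻¹ = η⁻¹ − 2H ℓ♯ ⊗ ℓ♯` (valid since `ℓ` is `η`-null).
Kerr–Schild 1965, §2; Visser, arXiv:0706.0622, §5. [cite: KerrSchild1965, §2] -/
def coSharp (M a : ℝ) (x : E4) (p : E4 →ₗ[ℝ] ℝ) : E4 :=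
  etaSharp p - (2 * scalarH M a x * p (nullVector a x)) • nullVector a x

/-- `g(g♯p, w) = p(w)` wherever `r > 0`: `coSharp` inverts `♭` for the Kerr–Schild metric
(uses `ℓ(ℓ♯) = 0`). Kerr–Schild 1965, §2. [cite: KerrSchild1965, §2] -/
theorem bilin_coSharp (M a : ℝ) {x : E4} (hx : 0 < radius a x) (p : E4 →ₗ[ℝ] ℝ) (w : E4) :
    bilin M a x (coSharp M a x p) w = p w := by
  simp only [coSharp, bilin_apply, map_sub, map_smul, smul_eq_mul, FunLike.coe_sub,
    FunLike.coe_smul, Pi.sub_apply, Pi.smul_apply, Minkowski.bilin_etaSharp, bilin_nullVector,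
    nullCovector_etaSharp, nullCovector_nullVector hx]
  ring

/-- The musical isomorphism `♯` of the smooth Kerr metric is the explicit `coSharp`:
`g♯p = η♯p − 2H p(ℓ♯) ℓ♯`. Kerr–Schild 1965, §2; O'Neill 1983, Ch. 3, p. 60. [cite: KerrSchild1965, §2] -/
theorem sharp_smoothMetric [Facts] (M a r₀ : ℝ) (x : region a r₀) (p : E4 →ₗ[ℝ] ℝ) :
    (smoothMetric M a r₀).sharp x p = coSharp M a x.1 p := by
  have hflat : (smoothMetric M a r₀).flat x (coSharp M a x.1 p) = p := by
    apply LinearMap.ext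
    intro w
    rw [PseudoRiemannianMetric.flat_apply]
    exact bilin_coSharp M a (radius_pos_of_mem_region x.2) p w
  rw [← hflat, PseudoRiemannianMetric.sharp_flat, hflat]

/-- `p(η♯p) = −p₀² + p₁² + p₂² + p₃²` (`= η⁻¹(p, p)`). O'Neill 1983, Ch. 3, p. 60. [folklore] -/
theorem apply_etaSharp (p : E4 →ₗ[ℝ] ℝ) :
    p (etaSharp p) = -p (E4.basisVector 0) ^ 2 +
      (p (E4.basisVector 1) ^ 2 + p (E4.basisVector 2) ^ 2 + p (E4.basisVector 3) ^ 2) := by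
  rw [← Minkowski.bilin_etaSharp p (etaSharp p), Minkowski.bilin_apply, Fin.sum_univ_three]
  simp only [Fin.succ_zero_eq_one, Fin.succ_one_eq_two, fin_succ_two_eq_three,
    etaSharp_apply_zero, etaSharp_apply_one, etaSharp_apply_two, etaSharp_apply_three]
  ring

/-- The components of `ℓ♯`: `(ℓ♯)⁰ = −ℓ₀ = −1`. Kerr–Schild 1965; Visser arXiv:0706.0622, (34). [cite: arXiv07060622, (34)] -/
@[simp]
theorem nullVector_apply_zero (a : ℝ) (x : E4) : nullVector a x 0 = -1 := by
  simp [nullVector, nullCovectorFun]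

/-- The components of `ℓ♯`: `(ℓ♯)¹ = ℓ₁`. Kerr–Schild 1965; Visser arXiv:0706.0622, (34). [cite: arXiv07060622, (34)] -/
@[simp]
theorem nullVector_apply_one (a : ℝ) (x : E4) : nullVector a x 1 = nullCovectorFun a x 1 := by
  simp [nullVector]

/-- The components of `ℓ♯`: `(ℓ♯)² = ℓ₂`. Kerr–Schild 1965; Visser arXiv:0706.0622, (34). [cite: arXiv07060622, (34)] -/
@[simp]
theorem nullVector_apply_two (a : ℝ) (x : E4) : nullVector a x 2 = nullCovectorFun a x 2 := by
  simp [nullVector]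

/-- The components of `ℓ♯`: `(ℓ♯)³ = ℓ₃`. Kerr–Schild 1965; Visser arXiv:0706.0622, (34). [cite: arXiv07060622, (34)] -/
@[simp]
theorem nullVector_apply_three (a : ℝ) (x : E4) : nullVector a x 3 = nullCovectorFun a x 3 := by
  simp [nullVector]

/-- The spatial part `ℓ⃗` of the Kerr–Schild null covector is a Euclidean unit vector wherever
`r > 0`: `ℓ₁² + ℓ₂² + ℓ₃² = 1` (this is `ℓ(ℓ♯) = −ℓ₀² + |ℓ⃗|² = 0` with `ℓ₀ = 1`). Kerr–Schild
1965; Visser arXiv:0706.0622, (34)–(35). [cite: arXiv07060622, (34)–(35)] -/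
theorem sum_sq_nullCovectorFun {a : ℝ} {x : E4} (hx : 0 < radius a x) :
    nullCovectorFun a x 1 ^ 2 + nullCovectorFun a x 2 ^ 2 + nullCovectorFun a x 3 ^ 2 = 1 := by
  have h := nullCovector_nullVector hx
  rw [nullCovector, E4.covector_apply, Fin.sum_univ_four] at h
  simp only [nullVector_apply_zero, nullVector_apply_one, nullVector_apply_two,
    nullVector_apply_three] at h
  have h0 : nullCovectorFun a x 0 = 1 := by simp [nullCovectorFun]
  rw [h0] at h
  nlinarith [h]

/-- The differential `dψ_x` of a scalar field on the chart `{r > max r₀ 0}` as a linear functional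
on `E4` (`T_x = E4` for an open subset of `E4`; this merely fixes the syntactic type of
Mathlib's `mvfderiv`). Dafermos–Rodnianski, arXiv:0811.0354, §5.1. [folklore] -/
abbrev dcov {a r₀ : ℝ} (ψ : region a r₀ → ℝ) (x : region a r₀) : E4 →ₗ[ℝ] ℝ :=
  ((mvfderiv 𝓘(ℝ, E4) ψ x : TangentSpace 𝓘(ℝ, E4) x →L[ℝ] ℝ) :
    TangentSpace 𝓘(ℝ, E4) x →ₗ[ℝ] ℝ)

/-- `dψ_x(w) = dcov ψ x w` (definitional unfolding). [folklore] -/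
theorem mvfderiv_apply_eq_dcov {a r₀ : ℝ} (ψ : region a r₀ → ℝ) (x : region a r₀) (w : E4) :
    mvfderiv 𝓘(ℝ, E4) ψ x w = dcov ψ x w :=
  rfl

/-- The algebra of the coercivity bound: for `H ≥ 0` and a Euclidean unit vector `ℓ⃗`,
`s² + |p⃗|² ≤ 4 T`, where `4T = 4 (p(V))² + 2(1 + 2H) g⁻¹(p,p)` is written out with
`p(V) = s − 2H(−s + m)`, `g⁻¹(p,p) = −s² + |p⃗|² − 2H(−s + m)²`, `m = ℓ⃗·p⃗`
(`((1+2H)² − ½)(2Q − s² − P)` is a sum of squares plus `(1+4H)(P − m²) ≥ 0`). Elementary;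
DRSR arXiv:1402.7034, §3.1 (28) for the statement it quantifies. [folklore] -/
theorem coercivity_alg (H s p₁ p₂ p₃ l₁ l₂ l₃ : ℝ) (hH : 0 ≤ H)
    (hl : l₁ ^ 2 + l₂ ^ 2 + l₃ ^ 2 = 1) :
    s ^ 2 + (p₁ ^ 2 + p₂ ^ 2 + p₃ ^ 2) ≤
      4 * ((s - 2 * H * (-s + (l₁ * p₁ + l₂ * p₂ + l₃ * p₃))) *
            (s - 2 * H * (-s + (l₁ * p₁ + l₂ * p₂ + l₃ * p₃))) -
          (-s ^ 2 + (p₁ ^ 2 + p₂ ^ 2 + p₃ ^ 2) -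
              2 * H * (-s + (l₁ * p₁ + l₂ * p₂ + l₃ * p₃)) ^ 2) / 2 * (-1 - 2 * H)) := by
  set m : ℝ := l₁ * p₁ + l₂ * p₂ + l₃ * p₃ with hm
  set P : ℝ := p₁ ^ 2 + p₂ ^ 2 + p₃ ^ 2 with hP
  have hCS : m ^ 2 ≤ P := by
    have hlag : P * (l₁ ^ 2 + l₂ ^ 2 + l₃ ^ 2) - m ^ 2 =
        (l₁ * p₂ - l₂ * p₁) ^ 2 + (l₁ * p₃ - l₃ * p₁) ^ 2 + (l₂ * p₃ - l₃ * p₂) ^ 2 := by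
      rw [hm, hP]; ring
    rw [hl, mul_one] at hlag
    have hsos : 0 ≤ (l₁ * p₂ - l₂ * p₁) ^ 2 + (l₁ * p₃ - l₃ * p₁) ^ 2 + (l₂ * p₃ - l₃ * p₂) ^ 2 := by
      positivity
    linarith
  set Q : ℝ := 2 * ((1 + 2 * H) * s - 2 * H * m) ^ 2 +
    (1 + 2 * H) * (-s ^ 2 + P - 2 * H * (m - s) ^ 2) with hQ
  have hgoal : 4 * ((s - 2 * H * (-s + m)) * (s - 2 * H * (-s + m)) -
      (-s ^ 2 + P - 2 * H * (-s + m) ^ 2) / 2 * (-1 - 2 * H)) = 2 * Q := by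
    rw [hQ]; ring
  rw [hgoal]
  set α : ℝ := (1 + 2 * H) ^ 2 - 1 / 2 with hα
  have hαpos : 0 < α := by
    rw [hα]
    nlinarith [sq_nonneg H, hH]
  have hid : α * (2 * Q - s ^ 2 - P) =
      2 * ((α * s - 2 * H * (1 + 2 * H) * m) ^ 2 + (1 / 4 + 2 * H) * m ^ 2) +
        α * (1 + 4 * H) * (P - m ^ 2) := by
    rw [hQ, hα]; ring
  have hnn : 0 ≤ α * (2 * Q - s ^ 2 - P) := by
    rw [hid]
    have h2 : 0 ≤ α * (1 + 4 * H) * (P - m ^ 2) :=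
      mul_nonneg (mul_nonneg hαpos.le (by positivity)) (by linarith)
    have h3 : 0 ≤ 2 * ((α * s - 2 * H * (1 + 2 * H) * m) ^ 2 + (1 / 4 + 2 * H) * m ^ 2) := by
      positivity
    linarith
  have hnn' : 0 ≤ 2 * Q - s ^ 2 - P := (mul_nonneg_iff_of_pos_left hαpos).mp hnn
  linarith

/-- **Coercivity of the `V`-energy density in Kerr–Schild coordinates.** For `M ≥ 0` (so that
`H ≥ 0`), at every point of the chart `{r > max r₀ 0}` and for every scalar field `ψ`,
`∑_μ (∂_μ ψ)² ≤ 4 T[ψ](V, V)`, `V = −g♯dt* = Kerr.timeVector`: the Kerr–Schild energy density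
controls the full coordinate gradient with a *universal* constant (write `p = dψ`, `s = p₀`,
`m = ℓ⃗·p⃗`, `P = |p⃗|²`; then `4T = 2Q`, `Q = 2((1+2H)s − 2Hm)² + (1+2H)(P − s² − 2H(m − s)²)`,
and `coercivity_alg`). This is the quantitative form, for the Kerr–Schild multiplier, of the
comparability `∫ J^N_μ n^μ ∼ ‖∂ψ‖²_{L²}` of DRSR, arXiv:1402.7034, §3.1 (28). [cite: DafermosRodnianskiShlapentokhrothman2014, §3.1 (28)] -/
theorem sum_sq_mvfderiv_le_four_mul_stressEnergy [Facts] {M a r₀ : ℝ} (hM : 0 ≤ M)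
    (ψ : region a r₀ → ℝ) (x : region a r₀) :
    ∑ μ : Fin 4, (mvfderiv 𝓘(ℝ, E4) ψ x (E4.basisVector μ)) ^ 2 ≤
      4 * (smoothMetric M a r₀).stressEnergy ψ x (timeVector M a x.1) (timeVector M a x.1) := by
  have hx : 0 < radius a x.1 := radius_pos_of_mem_region x.2
  -- `p(ℓ♯) = −p₀ + ℓ⃗·p⃗`
  have hpl : dcov ψ x (nullVector a x.1) = -dcov ψ x (E4.basisVector 0) +
      (nullCovectorFun a x.1 1 * dcov ψ x (E4.basisVector 1) +
        nullCovectorFun a x.1 2 * dcov ψ x (E4.basisVector 2) +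
        nullCovectorFun a x.1 3 * dcov ψ x (E4.basisVector 3)) := by
    rw [E4.linearMap_apply_eq_sum, Fin.sum_univ_four]
    simp only [nullVector_apply_zero, nullVector_apply_one, nullVector_apply_two,
      nullVector_apply_three]
    ring
  -- `p(V) = p₀ − 2H p(ℓ♯)`
  have hpV : dcov ψ x (timeVector M a x.1) =
      dcov ψ x (E4.basisVector 0) - 2 * scalarH M a x.1 * dcov ψ x (nullVector a x.1) := by
    simp only [timeVector, map_sub, map_smul, smul_eq_mul]
  -- `g(V, V) = −1 − 2H`
  have hVV : (smoothMetric M a r₀).val x (timeVector M a x.1) (timeVector M a x.1) =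
      -1 - 2 * scalarH M a x.1 := by
    rw [smoothMetric_val]
    exact bilin_timeVector_timeVector hx
  -- `g⁻¹(p, p) = −p₀² + |p⃗|² − 2H p(ℓ♯)²`
  have hgrad : (smoothMetric M a r₀).gradSq ψ x =
      -dcov ψ x (E4.basisVector 0) ^ 2 +
        (dcov ψ x (E4.basisVector 1) ^ 2 + dcov ψ x (E4.basisVector 2) ^ 2 +
          dcov ψ x (E4.basisVector 3) ^ 2) -
        2 * scalarH M a x.1 * dcov ψ x (nullVector a x.1) ^ 2 := by
    rw [PseudoRiemannianMetric.gradSq, PseudoRiemannianMetric.innerDual, sharp_smoothMetric]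
    change dcov ψ x (coSharp M a x.1 (dcov ψ x)) = _
    simp only [coSharp, map_sub, map_smul, smul_eq_mul, apply_etaSharp]
    ring
  -- the left-hand side in components
  have hlhs : ∑ μ : Fin 4, (mvfderiv 𝓘(ℝ, E4) ψ x (E4.basisVector μ)) ^ 2 =
      dcov ψ x (E4.basisVector 0) ^ 2 +
        (dcov ψ x (E4.basisVector 1) ^ 2 + dcov ψ x (E4.basisVector 2) ^ 2 +
          dcov ψ x (E4.basisVector 3) ^ 2) := by
    simp only [mvfderiv_apply_eq_dcov, Fin.sum_univ_four]
    ring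
  rw [hlhs, PseudoRiemannianMetric.stressEnergy_apply]
  simp only [mvfderiv_apply_eq_dcov]
  rw [hpV, hgrad, hVV, hpl]
  exact coercivity_alg (scalarH M a x.1) _ _ _ _ _ _ _ (scalarH_nonneg hM a x.1)
    (sum_sq_nullCovectorFun hx)

/-! ### DRSR Corollary 3.1 (first estimate): the mis-stated first version (leaves `Σ̃_τ(h_{R₁})`) -/

/-- **Mis-stated (erratum of 2026-08-14, module docstring): false as written — do not consume
`(h : drsr_corollary_3_1_hyperboloidal_flux_decay)`; the corrected named fact is
`drsr_corollary_3_1_scri_flux_decay` below.** The leaves `Σ̃_τ(h_{R₁})` of this statement are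
exact translates, far out, of the prototype `Σ₂ = {t* = χ · (r + M log r)}` as printed in
arXiv:1010.5132, §4.4; along them `u = t − r* = −M log r + O(1) → −∞`, so they reach spacelike
infinity `i⁰` below every point of `𝓘⁺`, no energy leaves through `𝓘⁺` between two leaves, and
by the `J^T` energy identity the flux through `Σ̃_τ(h_{R₁})` is bounded below, for all large `τ`,
by the energy radiated to `𝓘⁺` up to any fixed retarded time: it does not decay for any solution
radiating to `𝓘⁺`, whereas the statement asserts `≤ C τ⁻²`. The printed hypothesis of Cor. 3.1
("an asymptotically hyperboloidal hypersurface terminating at null infinity") is not met by these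
leaves; the first version relied on the printed formula for `Σ₂` and on arXiv:1010.5132, p. 17
("`Σ₂` asymptotes to null infinity"), which are inconsistent with each other. Kept with its
original wording below for the record (D-0014: a vendored statement is never changed in place);
its only consumers are the (now vacuous) reductions `…_of_corollary_3_1` in this file.
Original docstring: **Dafermos–Rodnianski–Shlapentokh-Rothman, Corollary 3.1, first energy-flux
estimate, for the concrete foliation `Σ̃_τ = {t*_KS = τ + h_{R₁}(y)}`** (named fact, D-0014). As
printed (arXiv:1402.7034 = Ann. of Math. 183 (2016), §3.3, Cor. 3.1): for
`a₀ < M`, `|a| ≤ a₀`, `Σ̃₀` an asymptotically hyperboloidal hypersurface terminating at null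
infinity and `Σ̃_τ = φ_τ(Σ̃₀)`, sufficiently regular solutions of `□_{g_{a,M}} ψ = 0` satisfy
`∫_{Σ̃_τ} J^N_μ[ψ] n^μ_{Σ̃_τ} ≤ C(a₀, M) E τ⁻²`, `E` an appropriate higher-order weighted energy
on `Σ̃₀` (or on an asymptotically flat `Σ₀` in the past of `Σ̃₀`).
Vendored form: for `|a| < M` there is `R₀ = R₀(M, a) > 0` such that for every `R₁ ≥ R₀` and
every admissible wave `ψ` (`Literature.Geometry.Lorentzian.IsAdmissibleKerrWave`: smooth solution of `□_g ψ = 0` on the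
Kerr–Schild exterior chart with data compactly supported in the open slice `{t* = 0, r > r₊}`)
whose data are moreover supported in the coordinate ball `{‖y‖ ≤ R₁}`, there is a finite
constant `C = C(M, a, R₁, ψ)` with `leafFlux M a (hypHeight M a R₁) ψ τ ≤ C τ⁻²` for all `τ ≥ 1`,
i.e. `∫_{Σ̃_τ} J^V_μ[ψ] n^μ ≤ C τ⁻²` through the leaves `Σ̃_τ(h_{R₁})`.
Derivation from the printed statement: (i) `Σ̃₀(h_{R₁})` is, for `R₁ ≥ R₀(M,a)`, an admissible
hyperboloidal hypersurface (module docstring; arXiv:1010.5132, Def. 4.1) and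
`Σ̃_τ(h_{R₁}) = φ_τ Σ̃₀(h_{R₁})`; (ii) `{t* ≥ 0, r > r₊}` lies in the future Cauchy development
of the slice `{t* = 0, r > r₊}` and `ψ` vanishes there outside `J⁺(supp data)` (domain of
dependence, arXiv:1010.5132, Prop. 4.5.1), while for `|a| < M` and `R₁ ≥ R₀` the part
`{r > R₁}` of `Σ̃₀(h_{R₁})` is not reached from `{t* = 0, r ≤ R₁}` (future causal curves have
`dt/dr ≥ ((r²+a²) − |a|√Δ)/Δ = 1 + (2M − |a|)/r + O(r⁻²) > 1 + M/r`, the slope of `Σ₂`), so the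
data induced on `Σ̃₀(h_{R₁})` are smooth and compactly supported and `E < ∞`; `ψ` extends
smoothly to `𝓗⁺ ∩ {t* ≥ 0}` (solve from the zero-extended data on a horizon-penetrating slice),
so it is a "sufficiently regular solution" on `D⁺(Σ̃₀)` (arXiv:1402.7034, §4.1); (iii) the
multiplier `N` is replaced by the Kerr–Schild field `V` (footnote to Thm. 3.1; fluxes
comparable with constants `C(M, a)`, module docstring), and `C E` is absorbed into `C(M,a,R₁,ψ)`;
(iv) if the printed estimate is read for `τ ≥ τ₀` only, Thm. 3.1 (23) for `Σ̃₀(h_{R₁})` bounds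
the flux on `[1, τ₀]`. The vendored statement is weaker than the source (unspecified dependence
of the constant on `ψ`; only the first of the five estimates of Cor. 3.1). Instance hypotheses
`[Kerr.Facts] [Kerr.SliceFacts]` supply the Kerr metric and its Levi-Civita connection. [cite: DafermosRodnianskiShlapentokhrothman2014, Cor. 3.1 (first estimate) with §3.3; DafermosRodnianski2010KerrSmallA Def. 4.1, Prop. 4.5.1] -/
def drsr_corollary_3_1_hyperboloidal_flux_decay : Prop :=
  ∀ [Facts] [SliceFacts] (M a : ℝ), IsSubextremal M a →
    ∃ R₀ : ℝ, 0 < R₀ ∧ ∀ R₁ : ℝ, R₀ ≤ R₁ →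
      ∀ ψ : region a (rPlus M a) → ℝ, Literature.Geometry.Lorentzian.IsAdmissibleKerrWave M a ψ →
        (∀ x : region a (rPlus M a), (x : E4) 0 = 0 → R₁ < E4.spatialNorm (x : E4) →
            ψ x = 0 ∧ mfderiv 𝓘(ℝ, E4) 𝓘(ℝ, ℝ) ψ x = 0) →
          ∃ C : ℝ≥0∞, C < ⊤ ∧ ∀ τ : ℝ, 1 ≤ τ →
            leafFlux M a (hypHeight M a R₁) ψ τ ≤ C * ENNReal.ofReal (τ ^ (-2 : ℝ))

/-! ### DRSR Corollary 3.1 (first estimate) for the foliation `Σ̃_τ(h♯_{R₁})` terminating at `𝓘⁺` -/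

/-- **Dafermos–Rodnianski–Shlapentokh-Rothman, Corollary 3.1, first energy-flux estimate, for
the concrete hyperboloidal foliation `Σ̃_τ(h♯_{R₁}) = {t*_KS = τ + h♯_{R₁}(y)}` terminating at
`𝓘⁺`** (named fact, D-0014; corrected form of `drsr_corollary_3_1_hyperboloidal_flux_decay`, see
the erratum in the module docstring). As printed (arXiv:1402.7034 = Ann. of Math. 183 (2016),
§3.3, Cor. 3.1): for `a₀ < M`, `|a| ≤ a₀`, `Σ̃₀` an asymptotically hyperboloidal hypersurface
terminating at null infinity and `Σ̃_τ = φ_τ(Σ̃₀)`, sufficiently regular solutions of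
`□_{g_{a,M}} ψ = 0` satisfy `∫_{Σ̃_τ} J^N_μ[ψ] n^μ_{Σ̃_τ} ≤ C(a₀, M) E τ⁻²`, `E` an appropriate
higher-order weighted energy on `Σ̃₀` "(or alternatively on an asymptotically flat `Σ₀` in the
past of `Σ̃₀`)"; restated by Moschidis (arXiv:1509.08489, §1.3.3, pp. 16–17 of the arXiv text) for
any smooth spacelike `Σ̃₀` intersecting `𝓗⁺` transversally and terminating at `𝓘⁺`, any globally
timelike future-directed `T`-invariant `N` equal to `T` for `r ≫ 1`, with
`C = C(a, M, Σ̃₀, δ)`, "for any smooth solution … with suitably decaying initial data on `Σ̃₀`".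
Vendored form: for `|a| < M` there is `R₀ = R₀(M, a) > 0` such that for every `R₁ ≥ R₀` and
every admissible wave `ψ` (`Literature.Geometry.Lorentzian.IsAdmissibleKerrWave`: smooth solution of `□_g ψ = 0` on the
Kerr–Schild exterior chart with data compactly supported in the open slice `{t* = 0, r > r₊}`)
whose data are moreover supported in the coordinate ball `{‖y‖ ≤ R₁}`, there is a finite
constant `C = C(M, a, R₁, ψ)` with `leafFlux M a (scriHeight M a R₁) ψ τ ≤ C τ⁻²` for all `τ ≥ 1`,
i.e. `∫_{Σ̃_τ} J^V_μ[ψ] n^μ ≤ C τ⁻²` through the leaves `Σ̃_τ(h♯_{R₁})`.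
Derivation from the printed statement: (i) for `R₁ ≥ R₀(M, a)`, `Σ̃₀(h♯_{R₁})` is a smooth
spacelike hypersurface of the exterior, equal to the Kerr–Schild slice on `{r ≤ R₁}` (hence
transversal to `𝓗⁺`) and terminating at `𝓘⁺` (`u → u_∞` along it; module docstring, *The
corrected foliation*), and `Σ̃_τ(h♯_{R₁}) = φ_τ Σ̃₀(h♯_{R₁})`; (ii) `{t* ≥ 0, r > r₊}` lies in the
future Cauchy development of the slice `S₀ = {t* = 0, r > r₊}` (the leaves `{t* = const}` are
spacelike, `t*` decreases along past-directed causal curves, which have outward coordinate speed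
`≤ 1` and cannot reach `𝓗⁺`), so on `{t* ≥ 0, r > r₊} ⊇ J⁺(Σ̃₀(h♯_{R₁}))` the wave `ψ` coincides
with the solution `ψ̃` of the Cauchy problem for the zero-extended (smooth, compactly supported)
data on the horizon-penetrating slice `{t* = 0}`, smooth up to `𝓗⁺` (arXiv:1010.5132,
Prop. 4.5.1) — a "sufficiently regular solution" on `D⁺(Σ̃₀)` in the sense of arXiv:1402.7034,
§4.1; moreover the part `{r > R₁}` of `Σ̃₀(h♯_{R₁})` lies outside `J⁺(K)`, `K ⊆ S₀ ∩ {r ≤ R₁}` the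
support of the data ((iii) of *The corrected foliation* in the module docstring: future causal
curves obey `dt ≥ S₀(r) |dr|` in Boyer–Lindquist time, and the leaf has slope `G' < S₀` beyond
`R₁ ≥ R₀`), so the data induced by `ψ = ψ̃` on `Σ̃₀(h♯_{R₁})` are the given data on `{r ≤ R₁}` and
zero beyond: smooth and compactly supported, whence every weighted initial energy `E` of them is
finite; (iii) the multiplier `N` is replaced by the Kerr–Schild field `V = −g♯dt*` (footnote to
Thm. 3.1:
only `φ_τ`-invariance, strict timelikeness and `N → T` matter; `J^V_μ n^μ` and `J^N_μ n^μ` are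
comparable with constants `C(M, a)` for every future causal `n`, by the dominant energy condition
applied to `C V − N`, `C N − V`, module docstring), and `C E` is absorbed into `C(M, a, R₁, ψ)`;
(iv) the printed estimate concerns the whole foliation `Σ̃_τ`, `τ ≥ 0`; on any initial interval
`[1, τ₀]` it is in any case implied by boundedness, Thm. 3.1 (23) with §3.3. The vendored
statement is weaker than the source (unspecified dependence of the constant
on `ψ`; only the first of the five estimates of Cor. 3.1). Instance hypotheses
`[Kerr.Facts] [Kerr.SliceFacts]` supply the Kerr metric and its Levi-Civita connection. [cite: DafermosRodnianskiShlapentokhrothman2014, Cor. 3.1 (first estimate) with §3.3; Moschidis2016 §1.3.3; DafermosRodnianski2010KerrSmallA Prop. 4.5.1] -/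
def drsr_corollary_3_1_scri_flux_decay : Prop :=
  ∀ [Facts] [SliceFacts] (M a : ℝ), IsSubextremal M a →
    ∃ R₀ : ℝ, 0 < R₀ ∧ ∀ R₁ : ℝ, R₀ ≤ R₁ →
      ∀ ψ : region a (rPlus M a) → ℝ, Literature.Geometry.Lorentzian.IsAdmissibleKerrWave M a ψ →
        (∀ x : region a (rPlus M a), (x : E4) 0 = 0 → R₁ < E4.spatialNorm (x : E4) →
            ψ x = 0 ∧ mfderiv 𝓘(ℝ, E4) 𝓘(ℝ, ℝ) ψ x = 0) →
          ∃ C : ℝ≥0∞, C < ⊤ ∧ ∀ τ : ℝ, 1 ≤ τ →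
            leafFlux M a (scriHeight M a R₁) ψ τ ≤ C * ENNReal.ofReal (τ ^ (-2 : ℝ))

/-! ### Reduction of the coordinate local-energy decay to the flux decay -/

/-- On an open subset `U ⊆ E4`, the manifold differential of `ψ : U → ℝ` at `x` is the ordinary
derivative at `x` of the extension of `ψ` by zero (in which the prelude's `coordEnergyDensity`
is written); both sides are the junk value `0` when `ψ` is not differentiable at `x`. Chart
bookkeeping (the charts of `U` are restrictions of the identity chart of `E4`). [folklore] -/
theorem _root_.Literature.Geometry.Lorentzian.mvfderiv_eq_fderiv_extend (U : Opens E4) (ψ : U → ℝ) (x : U) (v : E4) :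
    mvfderiv 𝓘(ℝ, E4) ψ x v = fderiv ℝ (Function.extend Subtype.val ψ 0) x.1 v := by
  set ψt : E4 → ℝ := Function.extend Subtype.val ψ 0 with hψt
  -- `ψ = ψt ∘ val`
  have hcomp : ∀ z : U, ψt z.1 = ψ z := fun z ↦ Subtype.val_injective.extend_apply ψ 0 z
  -- the extended chart of `U` at `x` is `val` with local inverse `(chartAt E4 x).symm`
  have hext : ∀ z : U, extChartAt 𝓘(ℝ, E4) x z = z.1 := by
    intro z
    simp [TopologicalSpace.Opens.chartAt_eq]
  have hsymm : ∀ᶠ p in 𝓝 x.1, (ψ ∘ (extChartAt 𝓘(ℝ, E4) x).symm) p = ψt p := by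
    have h := TopologicalSpace.Opens.chartAt_subtype_val_symm_eventuallyEq (H := E4) U (x := x)
    simp only [chartAt_self_eq, OpenPartialHomeomorph.refl_symm, OpenPartialHomeomorph.refl_apply]
      at h
    filter_upwards [h] with p hp
    simp only [Function.comp_apply, extChartAt_coe_symm, modelWithCornersSelf_coe_symm,
      CompTriple.comp_eq] at hp ⊢
    have hp' : p = ((chartAt E4 x).symm p).1 := by simpa using hp
    conv_rhs => rw [hp']
    exact (hcomp _).symm
  have hwritten : writtenInExtChartAt 𝓘(ℝ, E4) 𝓘(ℝ, ℝ) x ψ = ψ ∘ (extChartAt 𝓘(ℝ, E4) x).symm := by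
    ext p
    simp [writtenInExtChartAt]
  by_cases hd : DifferentiableAt ℝ ψt x.1
  · -- differentiable case: `HasMFDerivAt ψ x (fderiv ψt x)`
    have hF : HasFDerivAt (ψ ∘ (extChartAt 𝓘(ℝ, E4) x).symm) (fderiv ℝ ψt x.1) x.1 :=
      hd.hasFDerivAt.congr_of_eventuallyEq hsymm
    have hM : HasMFDerivAt 𝓘(ℝ, E4) 𝓘(ℝ, ℝ) ψ x (fderiv ℝ ψt x.1) := by
      refine ⟨?_, ?_⟩
      · have hc : ContinuousAt ψt x.1 := hd.continuousAt
        have : ψ = ψt ∘ Subtype.val := funext fun z ↦ (hcomp z).symm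
        rw [this]
        exact hc.comp continuous_subtype_val.continuousAt
      · rw [hwritten, ModelWithCorners.range_eq_univ, hasFDerivWithinAt_univ, hext]
        exact hF
    have hmf := hM.mfderiv
    simp only [mvfderiv, hmf, ContinuousLinearMap.coe_comp, Function.comp_apply]
    rfl
  · -- non-differentiable case: both sides vanish
    have hnd : ¬MDifferentiableAt 𝓘(ℝ, E4) 𝓘(ℝ, ℝ) ψ x := by
      intro hmd
      apply hd
      have hM := hmd.hasMFDerivAt
      have hF : HasFDerivWithinAt (writtenInExtChartAt 𝓘(ℝ, E4) 𝓘(ℝ, ℝ) x ψ)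
          (mfderiv 𝓘(ℝ, E4) 𝓘(ℝ, ℝ) ψ x) (range 𝓘(ℝ, E4)) (extChartAt 𝓘(ℝ, E4) x x) := hM.2
      rw [hwritten, ModelWithCorners.range_eq_univ, hasFDerivWithinAt_univ, hext] at hF
      exact (hF.congr_of_eventuallyEq (hsymm.mono fun p hp ↦ hp.symm)).differentiableAt
    rw [fderiv_zero_of_not_differentiableAt hd]
    simp [mvfderiv, mfderiv_zero_of_not_mdifferentiableAt hnd]

/-- The prelude's coordinate energy density `∑_μ (∂_μ ψ̃)²` of the zero extension `ψ̃` at a point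
of the chart equals `∑_μ (dψ(∂_μ))²` for the manifold differential. Dafermos–Rodnianski,
arXiv:0811.0354, §4.1 (non-degenerate energy). [folklore] -/
theorem coordEnergyDensity_eq_sum_sq_mvfderiv {a r₀ : ℝ} (ψ : region a r₀ → ℝ)
    (x : region a r₀) :
    coordEnergyDensity (region a r₀) ψ x.1 =
      ∑ μ : Fin 4, (mvfderiv 𝓘(ℝ, E4) ψ x (E4.basisVector μ)) ^ 2 := by
  unfold coordEnergyDensity
  refine Finset.sum_congr rfl fun μ _ ↦ ?_
  rw [mvfderiv_eq_fderiv_extend]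

/-- **Coordinate energy is controlled by the `V`-flux density**: on the chart `{r > max r₀ 0}`
with `M ≥ 0`, `coordEnergyDensity ψ x ≤ 4 T[ψ](V, V)(x)`. Combination of
`coordEnergyDensity_eq_sum_sq_mvfderiv` and `sum_sq_mvfderiv_le_four_mul_stressEnergy`;
DRSR arXiv:1402.7034, §3.1 (28). [cite: DafermosRodnianskiShlapentokhrothman2014, §3.1 (28)] -/
theorem coordEnergyDensity_le_four_mul_stressEnergy [Facts] {M a r₀ : ℝ} (hM : 0 ≤ M)
    (ψ : region a r₀ → ℝ) (x : region a r₀) :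
    coordEnergyDensity (region a r₀) ψ x.1 ≤
      4 * (smoothMetric M a r₀).stressEnergy ψ x (timeVector M a x.1) (timeVector M a x.1) := by
  rw [coordEnergyDensity_eq_sum_sq_mvfderiv]
  exact sum_sq_mvfderiv_le_four_mul_stressEnergy hM ψ x

/-- On the coordinate ball `{‖y‖ ≤ R}` with `R < R₁`, the flux density over `y` of the leaf
`Σ̃_τ(h)` of a cut-off graph foliation (`h = cutoffHeight σ a R₁`, vanishing on `{r ≤ R₁}`) is
`T[ψ](V, V)(τ, y)`: the leaf is the Kerr–Schild slice there and its normal is `V`. DRSR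
arXiv:1402.7034, p. 51. [folklore] -/
theorem leafFluxDensity_cutoffHeight_of_norm_le [Facts] {σ : ℝ → ℝ} {M a R R₁ : ℝ} (hR₁ : 0 ≤ R₁)
    (hR : R < R₁) (ψ : region a (rPlus M a) → ℝ) (τ : ℝ) {y : E3} (hy : ‖y‖ ≤ R)
    (hmem : E4.ofTimeSpace τ y ∈ region a (rPlus M a)) :
    leafFluxDensity M a (cutoffHeight σ a R₁) ψ τ y =
      ENNReal.ofReal ((smoothMetric M a (rPlus M a)).stressEnergy ψ ⟨E4.ofTimeSpace τ y, hmem⟩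
        (timeVector M a (E4.ofTimeSpace τ y)) (timeVector M a (E4.ofTimeSpace τ y))) := by
  have hlt : radius a (E4.ofTimeSpace 0 y) < R₁ :=
    ((radius_ofTimeSpace_le_norm a 0 y).trans hy).trans_lt hR
  have h0 : cutoffHeight σ a R₁ y = 0 := cutoffHeight_eq_zero_of_radius_le hR₁ hlt.le
  have hpt : leafPoint (cutoffHeight σ a R₁) τ y = E4.ofTimeSpace τ y := leafPoint_of_eq_zero h0 τ
  have hmem' : leafPoint (cutoffHeight σ a R₁) τ y ∈ region a (rPlus M a) := hpt ▸ hmem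
  rw [leafFluxDensity_of_mem _ _ _ hmem']
  have hder : fderiv ℝ (cutoffHeight σ a R₁) (E4.spatial (E4.ofTimeSpace τ y)) = 0 := by
    rw [E4.spatial_ofTimeSpace]
    exact fderiv_cutoffHeight_eq_zero hR₁ hlt
  have hN : leafNormal M a (cutoffHeight σ a R₁) ⟨leafPoint (cutoffHeight σ a R₁) τ y, hmem'⟩ =
      timeVector M a (leafPoint (cutoffHeight σ a R₁) τ y) :=
    leafNormal_eq_timeVector _ (by simpa [hpt] using hder)
  rw [hN]
  congr 1
  -- transport along `leafPoint = ofTimeSpace τ y`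
  have : (⟨leafPoint (cutoffHeight σ a R₁) τ y, hmem'⟩ : region a (rPlus M a)) =
      ⟨E4.ofTimeSpace τ y, hmem⟩ := Subtype.ext hpt
  rw [this, hpt]

/-- On the coordinate ball `{‖y‖ ≤ R}` with `R < R₁`, the flux density of the leaf `Σ̃_τ(h_{R₁})`
over `y` is `T[ψ](V, V)(τ, y)` (the leaf is the Kerr–Schild slice there and its normal is `V`).
DRSR arXiv:1402.7034, p. 51. [folklore] -/
theorem leafFluxDensity_hypHeight_of_norm_le [Facts] {M a R R₁ : ℝ} (hR₁ : 0 ≤ R₁) (hR : R < R₁)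
    (ψ : region a (rPlus M a) → ℝ) (τ : ℝ) {y : E3} (hy : ‖y‖ ≤ R)
    (hmem : E4.ofTimeSpace τ y ∈ region a (rPlus M a)) :
    leafFluxDensity M a (hypHeight M a R₁) ψ τ y =
      ENNReal.ofReal ((smoothMetric M a (rPlus M a)).stressEnergy ψ ⟨E4.ofTimeSpace τ y, hmem⟩
        (timeVector M a (E4.ofTimeSpace τ y)) (timeVector M a (E4.ofTimeSpace τ y))) :=
  leafFluxDensity_cutoffHeight_of_norm_le hR₁ hR ψ τ hy hmem

/-- The same for the leaves `Σ̃_τ(h♯_{R₁})` terminating at `𝓘⁺`. DRSR arXiv:1402.7034, p. 51. [folklore] -/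
theorem leafFluxDensity_scriHeight_of_norm_le [Facts] {M a R R₁ : ℝ} (hR₁ : 0 ≤ R₁) (hR : R < R₁)
    (ψ : region a (rPlus M a) → ℝ) (τ : ℝ) {y : E3} (hy : ‖y‖ ≤ R)
    (hmem : E4.ofTimeSpace τ y ∈ region a (rPlus M a)) :
    leafFluxDensity M a (scriHeight M a R₁) ψ τ y =
      ENNReal.ofReal ((smoothMetric M a (rPlus M a)).stressEnergy ψ ⟨E4.ofTimeSpace τ y, hmem⟩
        (timeVector M a (E4.ofTimeSpace τ y)) (timeVector M a (E4.ofTimeSpace τ y))) :=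
  leafFluxDensity_cutoffHeight_of_norm_le hR₁ hR ψ τ hy hmem

/-- **Reduction of DRSR's local-energy decay (coordinate form) to `τ⁻²` decay of the `V`-flux
through the leaves of a cut-off graph foliation.** Let `σ M a : ℝ → ℝ` be any family of far
slopes and `h = cutoffHeight (σ M a) a R₁` the associated heights (vanishing on `{r ≤ R₁}`). If
for `|a| < M` there is `R₀ > 0` such that for all `R₁ ≥ R₀` and all admissible waves `ψ` with data
supported in `{‖y‖ ≤ R₁}` the flux `leafFlux M a h ψ τ ≤ C τ⁻²` (`τ ≥ 1`) for a finite `C`, then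
`Literature.Geometry.Lorentzian.drsr_wave_polynomial_decay_kerr` (`BlackHoles.lean`: `E_loc(τ, R) ≤ C' τ⁻²` for `τ ≥ 1`)
holds: given `ψ` with data supported in a compact `K`, choose `R₁ ≥ max(R₀, sup_K ‖y‖)` with
`R₁ > R`; on `{‖y‖ ≤ R}` the leaf `Σ̃_τ(h)` is the Kerr–Schild slice `{t* = τ}` with normal `V`,
where `coordEnergyDensity ≤ 4 T[ψ](V, V) = 4 ·` flux density
(`coordEnergyDensity_le_four_mul_stressEnergy`), so `E_loc(τ, R) ≤ 4 ∫_{Σ̃_τ} J^V_μ n^μ ≤ 4C τ⁻²`.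
DRSR arXiv:1402.7034, §3.3, Cor. 3.1 and p. 51. [cite: DafermosRodnianskiShlapentokhrothman2014, Cor. 3.1 and p. 51] -/
theorem _root_.Literature.Geometry.Lorentzian.drsr_wave_polynomial_decay_kerr_of_leafFlux_decay (σ : ℝ → ℝ → ℝ → ℝ)
    (hflux : ∀ [Facts] [SliceFacts] (M a : ℝ), IsSubextremal M a →
      ∃ R₀ : ℝ, 0 < R₀ ∧ ∀ R₁ : ℝ, R₀ ≤ R₁ →
        ∀ ψ : region a (rPlus M a) → ℝ, Literature.Geometry.Lorentzian.IsAdmissibleKerrWave M a ψ →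
          (∀ x : region a (rPlus M a), (x : E4) 0 = 0 → R₁ < E4.spatialNorm (x : E4) →
              ψ x = 0 ∧ mfderiv 𝓘(ℝ, E4) 𝓘(ℝ, ℝ) ψ x = 0) →
            ∃ C : ℝ≥0∞, C < ⊤ ∧ ∀ τ : ℝ, 1 ≤ τ →
              leafFlux M a (cutoffHeight (σ M a) a R₁) ψ τ ≤ C * ENNReal.ofReal (τ ^ (-2 : ℝ))) :
    Literature.Geometry.Lorentzian.drsr_wave_polynomial_decay_kerr := by
  intro _ _ M a hMa ψ hψ R
  have hM : 0 ≤ M := hMa.pos.le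
  obtain ⟨R₀, hR₀, hcor'⟩ := hflux M a hMa
  -- a coordinate ball containing the support of the data
  obtain ⟨K, hK, hsupp⟩ := hψ.2.2
  obtain ⟨RK, hRK⟩ : ∃ RK : ℝ, ∀ z ∈ K, E4.spatialNorm (z : E4) ≤ RK := by
    have hc : Continuous fun z : exterior M a ↦ E4.spatialNorm (z : E4) :=
      continuous_norm.comp (E4.spatial.continuous.comp continuous_subtype_val)
    obtain ⟨B, hB⟩ := hK.exists_bound_of_continuousOn hc.continuousOn
    refine ⟨B, fun z hz ↦ ?_⟩
    have := hB z hz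
    rwa [Real.norm_eq_abs, abs_of_nonneg (E4.spatialNorm_nonneg _)] at this
  set R₁ : ℝ := max R₀ (max RK (R + 1)) with hR₁
  have hR₀₁ : R₀ ≤ R₁ := le_max_left _ _
  have hRK₁ : RK ≤ R₁ := (le_max_left _ _).trans (le_max_right _ _)
  have hRR₁ : R < R₁ := (lt_add_one R).trans_le ((le_max_right _ _).trans (le_max_right _ _))
  have hR₁nn : 0 ≤ R₁ := hR₀.le.trans hR₀₁
  -- the support hypothesis of the flux-decay hypothesis
  have hdata : ∀ x : exterior M a, (x : E4) 0 = 0 → R₁ < E4.spatialNorm (x : E4) →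
      ψ x = 0 ∧ mfderiv 𝓘(ℝ, E4) 𝓘(ℝ, ℝ) ψ x = 0 := by
    intro x hx0 hxR
    refine hsupp x hx0 fun hxK ↦ ?_
    have := hRK x hxK
    linarith
  obtain ⟨C, hC, hflux'⟩ := hcor' R₁ hR₀₁ ψ hψ hdata
  refine ⟨4 * C, ENNReal.mul_lt_top (by simp) hC, fun τ hτ ↦ ?_⟩
  set h : E3 → ℝ := cutoffHeight (σ M a) a R₁ with hh
  -- pointwise comparison of the integrands on the ball
  have hpt : ∀ y ∈ Metric.closedBall (0 : E3) R,
      Set.indicator {y : E3 | E4.ofTimeSpace τ y ∈ exterior M a}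
          (fun y ↦ ENNReal.ofReal (coordEnergyDensity (exterior M a) ψ (E4.ofTimeSpace τ y))) y ≤
        4 * leafFluxDensity M a h ψ τ y := by
    intro y hy
    rw [Metric.mem_closedBall, dist_zero_right] at hy
    by_cases hmem : E4.ofTimeSpace τ y ∈ exterior M a
    · have hmemset : y ∈ {y : E3 | E4.ofTimeSpace τ y ∈ exterior M a} := hmem
      rw [Set.indicator_of_mem hmemset]
      have hmem' : E4.ofTimeSpace τ y ∈ region a (rPlus M a) := hmem
      have h1 := leafFluxDensity_cutoffHeight_of_norm_le (σ := σ M a) hR₁nn hRR₁ ψ τ hy hmem'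
      have h2 := coordEnergyDensity_le_four_mul_stressEnergy hM ψ ⟨E4.ofTimeSpace τ y, hmem'⟩
      calc ENNReal.ofReal (coordEnergyDensity (exterior M a) ψ (E4.ofTimeSpace τ y))
          ≤ ENNReal.ofReal (4 * (smoothMetric M a (rPlus M a)).stressEnergy ψ
              ⟨E4.ofTimeSpace τ y, hmem'⟩ (timeVector M a (E4.ofTimeSpace τ y))
              (timeVector M a (E4.ofTimeSpace τ y))) := ENNReal.ofReal_le_ofReal h2
        _ = ENNReal.ofReal 4 * ENNReal.ofReal ((smoothMetric M a (rPlus M a)).stressEnergy ψ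
              ⟨E4.ofTimeSpace τ y, hmem'⟩ (timeVector M a (E4.ofTimeSpace τ y))
              (timeVector M a (E4.ofTimeSpace τ y))) := ENNReal.ofReal_mul (by norm_num)
        _ = 4 * leafFluxDensity M a h ψ τ y := by
            rw [hh, h1]
            congr 1
            simp
    · have hmemset : y ∉ {y : E3 | E4.ofTimeSpace τ y ∈ exterior M a} := hmem
      rw [Set.indicator_of_notMem hmemset]
      exact zero_le
  calc localSliceEnergy (exterior M a) ψ τ R
      ≤ ∫⁻ y in Metric.closedBall (0 : E3) R, 4 * leafFluxDensity M a h ψ τ y :=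
        setLIntegral_mono' measurableSet_closedBall hpt
    _ ≤ ∫⁻ y, 4 * leafFluxDensity M a h ψ τ y := setLIntegral_le_lintegral _ _
    _ = 4 * leafFlux M a h ψ τ := by
        rw [leafFlux, lintegral_const_mul' _ _ (by simp)]
    _ ≤ 4 * (C * ENNReal.ofReal (τ ^ (-2 : ℝ))) := by gcongr; exact hflux' τ hτ
    _ = 4 * C * ENNReal.ofReal (τ ^ (-2 : ℝ)) := (mul_assoc _ _ _).symm

/-- **Reduction of DRSR's local-energy decay (coordinate form) to Cor. 3.1 in flux form through
the foliation `Σ̃_τ(h♯_{R₁})` terminating at `𝓘⁺`** (the live reduction): the named fact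
`Literature.Geometry.Lorentzian.drsr_wave_polynomial_decay_kerr` of `BlackHoles.lean` follows from
`Kerr.drsr_corollary_3_1_scri_flux_decay` (instance `σ = scriSlope` of
`Literature.Geometry.Lorentzian.drsr_wave_polynomial_decay_kerr_of_leafFlux_decay`). DRSR arXiv:1402.7034, §3.3,
Cor. 3.1 and p. 51. [cite: DafermosRodnianskiShlapentokhrothman2014, Cor. 3.1 and p. 51] -/
theorem _root_.Literature.Geometry.Lorentzian.drsr_wave_polynomial_decay_kerr_of_corollary_3_1_scri
    (hcor : drsr_corollary_3_1_scri_flux_decay) :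
    Literature.Geometry.Lorentzian.drsr_wave_polynomial_decay_kerr :=
  Literature.Geometry.Lorentzian.drsr_wave_polynomial_decay_kerr_of_leafFlux_decay scriSlope fun M a hMa ↦ hcor M a hMa

/-- Reduction of `Literature.Geometry.Lorentzian.drsr_wave_polynomial_decay_kerr` to the first version's named fact
`Kerr.drsr_corollary_3_1_hyperboloidal_flux_decay` (instance `σ = hypSlope` of
`Literature.Geometry.Lorentzian.drsr_wave_polynomial_decay_kerr_of_leafFlux_decay`). **The antecedent is mis-stated
(false as written; erratum in the module docstring), so this implication is vacuous; it is kept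
for the record. The live reduction is `…_of_corollary_3_1_scri`.** DRSR arXiv:1402.7034, §3.3,
Cor. 3.1 and p. 51. [cite: DafermosRodnianskiShlapentokhrothman2014, Cor. 3.1 and p. 51] -/
theorem _root_.Literature.Geometry.Lorentzian.drsr_wave_polynomial_decay_kerr_of_corollary_3_1
    (hcor : drsr_corollary_3_1_hyperboloidal_flux_decay) :
    Literature.Geometry.Lorentzian.drsr_wave_polynomial_decay_kerr :=
  Literature.Geometry.Lorentzian.drsr_wave_polynomial_decay_kerr_of_leafFlux_decay hypSlope fun M a hMa ↦ hcor M a hMa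

/-- Corollary of the live reduction: the qualitative local-energy decay `E_loc(τ, R) → 0` of
`BlackHoles.lean` (`Literature.Geometry.Lorentzian.drsr_wave_local_energy_decay_kerr`) follows from Cor. 3.1 in flux
form through `Σ̃_τ(h♯_{R₁})` (compose with `drsr_wave_local_energy_decay_kerr_of_polynomial_decay`).
DRSR arXiv:1402.7034, Cor. 3.1. [cite: DafermosRodnianskiShlapentokhrothman2014, Cor. 3.1] -/
theorem _root_.Literature.Geometry.Lorentzian.drsr_wave_local_energy_decay_kerr_of_corollary_3_1_scri
    (hcor : drsr_corollary_3_1_scri_flux_decay) :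
    Literature.Geometry.Lorentzian.drsr_wave_local_energy_decay_kerr :=
  Literature.Geometry.Lorentzian.drsr_wave_local_energy_decay_kerr_of_polynomial_decay
    (Literature.Geometry.Lorentzian.drsr_wave_polynomial_decay_kerr_of_corollary_3_1_scri hcor)

/-- Corollary of the vacuous reduction (kept for the record; the antecedent is mis-stated, see
the erratum): `E_loc(τ, R) → 0` from the first version's named fact. DRSR arXiv:1402.7034,
Cor. 3.1. [cite: DafermosRodnianskiShlapentokhrothman2014, Cor. 3.1] -/
theorem _root_.Literature.Geometry.Lorentzian.drsr_wave_local_energy_decay_kerr_of_corollary_3_1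
    (hcor : drsr_corollary_3_1_hyperboloidal_flux_decay) :
    Literature.Geometry.Lorentzian.drsr_wave_local_energy_decay_kerr :=
  Literature.Geometry.Lorentzian.drsr_wave_local_energy_decay_kerr_of_polynomial_decay
    (Literature.Geometry.Lorentzian.drsr_wave_polynomial_decay_kerr_of_corollary_3_1 hcor)

end Kerr

end Literature.Geometry.Lorentzian

end
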